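import Literature.Algebra.EuclideanLattices.FarCertMachineCodes
import Literature.Algebra.EuclideanLattices.GapCVPCoNPComplete
import HarnessLib

/-!
# The verifier machine of the integer coNP certificate for `GapCVP`, II: the tests, the machine, and the discharge of `FarCert.verifier_mem_P`

Topic `Algebra/EuclideanLattices` (family `pqc`), continuing `FarCertMachineCodes.lean`. Everything is
PROVED; the main result is

* `FarCert.verifier_mem_P_holds : FarCert.verifier_mem_P` — the acceptance predicate `FarCert.Accepts`
  (`GapCVPCoNPWitness.lean`: `δ ≠ 0`, `C B = B C = δ I`, `σ ≠ 0`, `σ² Q = RᵀR` for the moment matrix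
  `Q = N den² BBᵀ − 20000 num² AᵀA`, and `N < 4 · #far phases`) is decided in polynomial time on the
  code of the instance paired with a coded certificate, by a language `farCertLang ∈ P` that accepts
  EXACTLY the strings denoting accepted certificates (total decoding), with a coding `encCert` of
  linear length in the bit size.

Design (Aharonov–Regev 2005, §6, p. 10: "easy to see"; here at the `TM2` level through the `FP`
string algebra). The witness format is ours: `y = ⟨bin N, ⟨U, ⟨W, ⟨δ, ⟨bin m, ⟨Rt, bin σ⟩⟩⟩⟩⟩⟩` with
the matrices TRANSPOSED (`U = Aᵀ`, `W = Cᵀ`, `Rt = Rᵀ`, as coded lists of coded rows), so that every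
product the verifier needs is a dot product of stored rows (`dotF`): `(B C)_{ik} = bᵢ · w_k`,
`(BBᵀ)_{ik} = bᵢ · b_k`, `(AᵀA)_{ik} = uᵢ · u_k`, `(RᵀR)_{ik} = rtᵢ · rt_k`, `(t C)_k = w_k · t`; only
the phases `(A g)_j = col_j(U) · g` use a column (`colF`).

* the record `mkG` of normalised data (yardstick `Y = w ++ w ++ w`, whose length `L = 3|w|` clocks
  every loop and bounds every count; `prepW`, `prepW_input`);
* the tests as one-bit bricks with truth lemmas: `invItem`/`pairsAllF` (`B Wᵀ = δ I`, nested `allFn`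
  over `idxList n`), `momItem` (`σ²(N den² bᵢ·b_k − 20000 num² uᵢ·u_k) = rtᵢ·rt_k`), `farBitF`
  (`FarCert.FarOf` in integer form, `farBitF_dpEnc`), `phasePiece`/`farCntF` (the far count by
  `foldLoop addFn`), `testsF_apply`;
* `gVecF` — `g = t C`, capped at width `|Y|`, with NO overflow (`natAbs_dg_lt`:
  `|g_k| < 2^{2|x| + |y|} ≤ 2^{|Y|}`);
* **`verifW_input`**: on `⟨code ((B, t), d), y⟩`, for EVERY string `y`, the machine returns the bit of
  `MachineAcc` — the tests on the data `dN, dU, dW, dδ, dM, dRt, dσ` decoded totally from `y`;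
  `accepts_decCert_iff` identifies it with `Accepts` of the decoded certificate `decCert` (the
  redundant test `C B = δ I` follows from `B C = δ I`, `mul_eq_smul_one_comm`, over `ℚ` by
  `mul_eq_one_comm`); `accepts_congr` transports `Accepts` along the recovered counts
  (`accepts_decCert_encCert`); dimension `0` accepts nothing (`not_accepts_of_n_zero`);
* clauses (i) `verifW_encCert`, (ii) `accepts_decCert_of_verifW`, (iii) `length_encCert_le`
  (`|encCert c| ≤ 40 · bitSize c + 40`), and `FarCert.verifier_mem_P_holds`.

## References

* D. Aharonov, O. Regev, *Lattice problems in NP ∩ coNP*, J. ACM 52 (2005) 749–765, §6 (p. 10,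
  tests (a)–(c)), Thm. 1.1.
* S. Arora, B. Barak, *Computational Complexity: A Modern Approach*, CUP 2009, §1.3, Def. 1.13.
-/

namespace Literature.Algebra.EuclideanLattices

open _root_.Computability Literature.Computability.Complexity Literature.Computability.Complexity.Brick Polynomial
open LLLMachine PRelSigPi OracleCompose GMSS Matrix

namespace FarCertMachine

/-! ### Columns of rectangular tables -/

/-- **A column of a rectangular table**: `colF ⟨x, ⟨bin n', ⟨bin l, matCode M⟩⟩⟩ = rowCode (M · l)` for
`l < m`, `n', l ≤ |x|`. [folklore] -/
theorem colF_matCode (x : List Bool) {n' m : ℕ} (hn : n' ≤ x.length) {l : ℕ} (hl : l < m) (hlx : l ≤ x.length)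
    (M : Fin n' → Fin m → ℤ) :
    colF (boolPair x (boolPair (encodeNat n') (boolPair (encodeNat l) (matCode M)))) = rowCode (fun i => M i ⟨l, hl⟩) := by
  rw [colF, matCode, mapLF_apply _ _ _ hn, List.take_of_length_le (by simp), List.map_ofFn, rowCode, zlist_eq, List.map_ofFn]
  refine congrArg encList (congrArg List.ofFn (funext fun i => ?_))
  simp only [Function.comp_apply]
  rw [rowCode, zlist_eq, nthLF_apply x hlx, getD_map_dpEnc _ _ (by simp [hl])]
  simp

/-! ### The far test on one phase -/

/-- **The far test** on `⟨dδ, dp⟩` (canonical codes of `δ` and of a phase `p`): with `D = |δ|` and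
`r = p mod D`, the bit `[D ≤ 8 r ∧ D ≤ 8 (D − r)]` (`FarCert.FarOf` in integer form). [cite: AharonovRegev2005, §6 test (a) — integer counting form] -/
noncomputable def farBitF : List Bool → List Bool :=
  andFn (zleF ∘ fanoutFn (nthF 0) (zmulF ∘ fanoutFn (fun _ => dpEnc 8) (sndPow 1)))
    (zleF ∘ fanoutFn (nthF 0) (zmulF ∘ fanoutFn (fun _ => dpEnc 8) (zsubF ∘ fanoutFn (nthF 0) (sndPow 1)))) ∘
  -- the record `⟨D, ⟨p, r⟩⟩`
  fanoutFn (zabsF ∘ fstF) (fanoutFn sndF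
    (zsubF ∘ fanoutFn sndF (zmulF ∘ fanoutFn (zabsF ∘ fstF) (zedivF ∘ fanoutFn sndF (zabsF ∘ fstF)))))

/-- `farBitF ∈ FP`. [folklore] -/
theorem farBitF_mem_FP : farBitF ∈ FP :=
  comp_mem_FP
    (andFn_mem_FP (comp_mem_FP zleF_mem_FP (fanoutFn_mem_FP (nthF_mem_FP 0) (comp_mem_FP zmulF_mem_FP (fanoutFn_mem_FP (const_mem_FP _) (sndPow_mem_FP 1)))))
      (comp_mem_FP zleF_mem_FP (fanoutFn_mem_FP (nthF_mem_FP 0) (comp_mem_FP zmulF_mem_FP (fanoutFn_mem_FP (const_mem_FP _)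
        (comp_mem_FP zsubF_mem_FP (fanoutFn_mem_FP (nthF_mem_FP 0) (sndPow_mem_FP 1))))))))
    (fanoutFn_mem_FP (comp_mem_FP zabsF_mem_FP fstF_mem_FP) (fanoutFn_mem_FP sndF_mem_FP (comp_mem_FP zsubF_mem_FP
      (fanoutFn_mem_FP sndF_mem_FP (comp_mem_FP zmulF_mem_FP (fanoutFn_mem_FP (comp_mem_FP zabsF_mem_FP fstF_mem_FP)
        (comp_mem_FP zedivF_mem_FP (fanoutFn_mem_FP sndF_mem_FP (comp_mem_FP zabsF_mem_FP fstF_mem_FP)))))))))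

/-- `farBitF` is one-bit. [folklore] -/
theorem oneBit_farBitF : OneBit farBitF :=
  (oneBit_andFn (oneBit_zleF.comp _) (oneBit_zleF.comp _)).comp _

/-- **Truth of the far test**: on canonical codes, `farBitF ⟨dpEnc δ, dpEnc p⟩` is the integer far test of
`FarCert.FarOf` (`|δ| ≤ 8 (p mod |δ|) ∧ |δ| ≤ 8 (|δ| − p mod |δ|)`). [cite: AharonovRegev2005, §6 test (a)] -/
theorem farBitF_dpEnc (δ p : ℤ) :
    farBitF (boolPair (dpEnc δ) (dpEnc p)) =
      [decide ((δ.natAbs : ℤ) ≤ 8 * (p % δ.natAbs) ∧ (δ.natAbs : ℤ) ≤ 8 * (δ.natAbs - p % δ.natAbs))] := by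
  have hr : p - |δ| * (p / |δ|) = p % |δ| := by rw [Int.emod_def]
  have habs : (|δ| : ℤ) = (δ.natAbs : ℤ) := Int.abs_eq_natAbs δ
  simp only [farBitF, Function.comp_apply, fanoutFn_apply, fstF_boolPair, sndF_boolPair, zabsF_dpEnc, zedivF_dpEnc,
    zmulF_boolPair, zsubF_boolPair, ival_dpEnc]
  rw [hr, andFn, iteFn_of_oneBit (oneBit_zleF.comp _)]
  simp only [Function.comp_apply, fanoutFn_apply, nthF_zero_boolPair, sndPow_succ_boolPair, sndPow_zero, sndF_boolPair,
    zleF_boolPair, zmulF_boolPair, zsubF_boolPair, ival_dpEnc]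
  rw [← habs]
  by_cases h1 : (|δ| : ℤ) ≤ 8 * (p % δ) <;> by_cases h2 : (|δ| : ℤ) ≤ 8 * (|δ| - p % δ) <;> simp [h1, h2]


/-! ### The record of normalised data -/

/-- The record `G = ⟨Y, ⟨bin n, ⟨Bn, ⟨tn, ⟨bin N, ⟨Un, ⟨Wn, ⟨dδ, ⟨bin m, ⟨Rtn, ⟨yσ, ⟨num, ⟨den, ⟨idx, gn⟩…⟩`
of the yardstick, the dimension, the normalised basis, target, sample count, samples (transposed),
inverse (transposed), `δ`, row count and certificate (transposed), `σ`, `|num d|`, `den d`, the index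
list and the vector `g = t C`. [folklore] -/
def mkG (Y nn Bn tn NN Un Wn dd mm Rtn ys num den idx gn : List Bool) : List Bool :=
  boolPair Y (boolPair nn (boolPair Bn (boolPair tn (boolPair NN (boolPair Un (boolPair Wn (boolPair dd (boolPair mm
    (boolPair Rtn (boolPair ys (boolPair num (boolPair den (boolPair idx gn)))))))))))))

section Fields
variable (Y nn Bn tn NN Un Wn dd mm Rtn ys num den idx gn : List Bool)
/-- Field `0` of `G`. [folklore] -/
@[simp] theorem nthF0_mkG : nthF 0 (mkG Y nn Bn tn NN Un Wn dd mm Rtn ys num den idx gn) = Y := by simp [mkG]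
/-- Field `1` of `G`. [folklore] -/
@[simp] theorem nthF1_mkG : nthF 1 (mkG Y nn Bn tn NN Un Wn dd mm Rtn ys num den idx gn) = nn := by simp [mkG]
/-- Field `2` of `G`. [folklore] -/
@[simp] theorem nthF2_mkG : nthF 2 (mkG Y nn Bn tn NN Un Wn dd mm Rtn ys num den idx gn) = Bn := by simp [mkG]
/-- Field `3` of `G`. [folklore] -/
@[simp] theorem nthF3_mkG : nthF 3 (mkG Y nn Bn tn NN Un Wn dd mm Rtn ys num den idx gn) = tn := by simp [mkG]
/-- Field `4` of `G`. [folklore] -/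
@[simp] theorem nthF4_mkG : nthF 4 (mkG Y nn Bn tn NN Un Wn dd mm Rtn ys num den idx gn) = NN := by simp [mkG]
/-- Field `5` of `G`. [folklore] -/
@[simp] theorem nthF5_mkG : nthF 5 (mkG Y nn Bn tn NN Un Wn dd mm Rtn ys num den idx gn) = Un := by simp [mkG]
/-- Field `6` of `G`. [folklore] -/
@[simp] theorem nthF6_mkG : nthF 6 (mkG Y nn Bn tn NN Un Wn dd mm Rtn ys num den idx gn) = Wn := by simp [mkG]
/-- Field `7` of `G`. [folklore] -/
@[simp] theorem nthF7_mkG : nthF 7 (mkG Y nn Bn tn NN Un Wn dd mm Rtn ys num den idx gn) = dd := by simp [mkG]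
/-- Field `8` of `G`. [folklore] -/
@[simp] theorem nthF8_mkG : nthF 8 (mkG Y nn Bn tn NN Un Wn dd mm Rtn ys num den idx gn) = mm := by simp [mkG]
/-- Field `9` of `G`. [folklore] -/
@[simp] theorem nthF9_mkG : nthF 9 (mkG Y nn Bn tn NN Un Wn dd mm Rtn ys num den idx gn) = Rtn := by simp [mkG]
/-- Field `10` of `G`. [folklore] -/
@[simp] theorem nthF10_mkG : nthF 10 (mkG Y nn Bn tn NN Un Wn dd mm Rtn ys num den idx gn) = ys := by simp [mkG]
/-- Field `11` of `G`. [folklore] -/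
@[simp] theorem nthF11_mkG : nthF 11 (mkG Y nn Bn tn NN Un Wn dd mm Rtn ys num den idx gn) = num := by simp [mkG]
/-- Field `12` of `G`. [folklore] -/
@[simp] theorem nthF12_mkG : nthF 12 (mkG Y nn Bn tn NN Un Wn dd mm Rtn ys num den idx gn) = den := by simp [mkG]
/-- Field `13` of `G`. [folklore] -/
@[simp] theorem nthF13_mkG : nthF 13 (mkG Y nn Bn tn NN Un Wn dd mm Rtn ys num den idx gn) = idx := by simp [mkG]
/-- The last field of `G`. [folklore] -/
@[simp] theorem sndPow13_mkG : sndPow 13 (mkG Y nn Bn tn NN Un Wn dd mm Rtn ys num den idx gn) = gn := by simp [mkG]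
end Fields

/-- Rows of a matrix code by `nthLF`. [folklore] -/
theorem nthLF_matCode (x : List Bool) {n' m : ℕ} {i : ℕ} (hi : i < n') (hix : i ≤ x.length) (M : Fin n' → Fin m → ℤ) :
    nthLF (boolPair x (boolPair (encodeNat i) (matCode M))) = rowCode (M ⟨i, hi⟩) := by
  rw [matCode, nthLF_apply x hix, List.getD_eq_getElem _ _ (by simpa using hi)]
  simp

/-- Items of the index list are the unary numerals below the bound. [folklore] -/
theorem forall_decNil_idxList {k : ℕ} {P : List Bool → Prop} :
    (∀ a ∈ decNil (encList ((List.range k).map ones)), P a) ↔ ∀ i, i < k → P (ones i) := by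
  rw [decNil_encList]
  simp

/-! ### Test (b): `B C = δ I` (all pairs of a row of `B` and a row of `W = Cᵀ`) -/

/-- Accessors of the test record `r = ⟨⟨G, a⟩, b⟩`. [folklore] -/
def rG : List Bool → List Bool := fstF ∘ fstF
/-- The first index of the test record. [folklore] -/
def rA : List Bool → List Bool := sndF ∘ fstF
/-- The second index of the test record. [folklore] -/
def rB : List Bool → List Bool := sndF

/-- `rG ∈ FP`. [folklore] -/
theorem rG_mem_FP : rG ∈ FP := comp_mem_FP fstF_mem_FP fstF_mem_FP
/-- `rA ∈ FP`. [folklore] -/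
theorem rA_mem_FP : rA ∈ FP := comp_mem_FP sndF_mem_FP fstF_mem_FP
/-- `rB ∈ FP`. [folklore] -/
theorem rB_mem_FP : rB ∈ FP := sndF_mem_FP

/-- The dot product of row `|a|` of the table in field `p` with row `|b|` of the table in field `q`,
with length counter in field `c`: on `r = ⟨⟨G, a⟩, b⟩`. [folklore] -/
noncomputable def dotRowsF (c p q : ℕ) : List Bool → List Bool :=
  dotF ∘ fanoutFn (nthF 0 ∘ rG) (fanoutFn (nthF c ∘ rG)
    (fanoutFn (nthLF ∘ fanoutFn (nthF 0 ∘ rG) (fanoutFn (lenBinF ∘ rA) (nthF p ∘ rG)))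
              (nthLF ∘ fanoutFn (nthF 0 ∘ rG) (fanoutFn (lenBinF ∘ rB) (nthF q ∘ rG)))))

/-- `dotRowsF c p q ∈ FP`. [folklore] -/
theorem dotRowsF_mem_FP (c p q : ℕ) : dotRowsF c p q ∈ FP :=
  comp_mem_FP dotF_mem_FP (fanoutFn_mem_FP (comp_mem_FP (nthF_mem_FP 0) rG_mem_FP) (fanoutFn_mem_FP (comp_mem_FP (nthF_mem_FP c) rG_mem_FP)
    (fanoutFn_mem_FP (comp_mem_FP nthLF_mem_FP (fanoutFn_mem_FP (comp_mem_FP (nthF_mem_FP 0) rG_mem_FP)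
      (fanoutFn_mem_FP (comp_mem_FP lenBinF_mem_FP rA_mem_FP) (comp_mem_FP (nthF_mem_FP p) rG_mem_FP))))
      (comp_mem_FP nthLF_mem_FP (fanoutFn_mem_FP (comp_mem_FP (nthF_mem_FP 0) rG_mem_FP)
        (fanoutFn_mem_FP (comp_mem_FP lenBinF_mem_FP rB_mem_FP) (comp_mem_FP (nthF_mem_FP q) rG_mem_FP)))))))

/-- The test item of (b) on `⟨⟨G, 1ⁱ⟩, 1ᵏ⟩`: `[row_i(B) · row_k(W) = δ [i = k]]`. [cite: AharonovRegev2005, §6 (the verifier checks the inverse) — integer form] -/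
noncomputable def invItem : List Bool → List Bool :=
  isZeroFn ∘ zsubF ∘ fanoutFn (dotRowsF 1 2 6) (iteFn (eqPairFn ∘ fanoutFn rA rB) (nthF 7 ∘ rG) (fun _ => dpEnc 0))

/-- `invItem ∈ FP`. [folklore] -/
theorem invItem_mem_FP : invItem ∈ FP :=
  comp_mem_FP isZeroFn_mem_FP (comp_mem_FP zsubF_mem_FP (fanoutFn_mem_FP (dotRowsF_mem_FP 1 2 6)
    (iteFn_mem_FP (comp_mem_FP eqPairFn_mem_FP (fanoutFn_mem_FP rA_mem_FP rB_mem_FP)) (comp_mem_FP (nthF_mem_FP 7) rG_mem_FP) (const_mem_FP _))))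

/-- `invItem` is one-bit. [folklore] -/
theorem oneBit_invItem : OneBit invItem := oneBit_isZeroFn.comp _

/-- **Truth of the test item of (b)**. [folklore] -/
theorem invItem_apply {n : ℕ} (Y tn NN Un mm Rtn ys num den idx gn : List Bool) (hn : n ≤ Y.length)
    (B W : Fin n → Fin n → ℤ) (δ : ℤ) (i k : Fin n) :
    invItem (boolPair (boolPair (mkG Y (encodeNat n) (matCode B) tn NN Un (matCode W) (dpEnc δ) mm Rtn ys num den idx gn) (ones i)) (ones k)) =
      [decide (∑ l, B i l * W k l = if i = k then δ else 0)] := by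
  have hi : (i : ℕ) ≤ Y.length := le_trans i.isLt.le hn
  have hk : (k : ℕ) ≤ Y.length := le_trans k.isLt.le hn
  have hd : dotRowsF 1 2 6 (boolPair (boolPair (mkG Y (encodeNat n) (matCode B) tn NN Un (matCode W) (dpEnc δ) mm Rtn ys num den idx gn)
      (ones i)) (ones k)) = dpEnc (∑ l, B i l * W k l) := by
    simp only [dotRowsF, rG, rA, rB, Function.comp_apply, fanoutFn_apply, fstF_boolPair, sndF_boolPair, nthF0_mkG, nthF1_mkG,
      nthF2_mkG, nthF6_mkG, lenBinF_apply, List.length_replicate]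
    rw [nthLF_matCode Y i.isLt hi, nthLF_matCode Y k.isLt hk, dotF_apply Y hn]
  have he : (eqPairFn ∘ fanoutFn rA rB) (boolPair (boolPair (mkG Y (encodeNat n) (matCode B) tn NN Un (matCode W) (dpEnc δ) mm Rtn ys num den idx gn)
      (ones i)) (ones k)) = [decide (i = k)] := by
    simp only [rA, rB, Function.comp_apply, fanoutFn_apply, fstF_boolPair, sndF_boolPair, eqPairFn_boolPair]
    by_cases h : i = k
    · simp [h]
    · have hne : (i : ℕ) ≠ k := fun e => h (Fin.ext e)
      have : ones i ≠ ones k := fun e => hne (by simpa [ones] using congrArg List.length e)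
      simp [h, this]
  rw [invItem, Function.comp_apply, Function.comp_apply, fanoutFn_apply, hd, iteFn_of_oneBit (oneBit_eqPairFn.comp _), he]
  simp only [rG, Function.comp_apply, fstF_boolPair, nthF7_mkG, zsubF_boolPair, ival_dpEnc, isZeroFn_apply]
  by_cases h : i = k
  · simp [h, sub_eq_zero]
  · simp [h]


/-- **Test (b)** on `G`: all pairs `(i, k)` pass `invItem`. [cite: AharonovRegev2005, §6 (p. 10)] -/
noncomputable def invTestF : List Bool → List Bool :=
  allFn (allFn invItem ∘ fanoutFn id (nthF 13 ∘ fstF)) ∘ fanoutFn id (nthF 13)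

/-- `invTestF ∈ FP`. [folklore] -/
theorem invTestF_mem_FP : invTestF ∈ FP :=
  comp_mem_FP (allFn_mem_FP (comp_mem_FP (allFn_mem_FP invItem_mem_FP oneBit_invItem) (fanoutFn_mem_FP id_mem_FP (comp_mem_FP (nthF_mem_FP 13) fstF_mem_FP)))
    ((oneBit_allFn oneBit_invItem).comp _)) (fanoutFn_mem_FP id_mem_FP (nthF_mem_FP 13))

/-- `invTestF` is one-bit. [folklore] -/
theorem oneBit_invTestF : OneBit invTestF := (oneBit_allFn ((oneBit_allFn oneBit_invItem).comp _)).comp _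

/-- **Truth of test (b)**: `B Wᵀ = δ I` entrywise, i.e. `B C = δ I` for `C = Wᵀ`. [folklore] -/
theorem invTestF_apply {n : ℕ} (Y tn NN Un mm Rtn ys num den gn : List Bool) (hn : n ≤ Y.length)
    (B W : Fin n → Fin n → ℤ) (δ : ℤ) :
    invTestF (mkG Y (encodeNat n) (matCode B) tn NN Un (matCode W) (dpEnc δ) mm Rtn ys num den (idxList n) gn) =
      [decide (∀ i k : Fin n, ∑ l, B i l * W k l = if i = k then δ else 0)] := by
  rw [invTestF, Function.comp_apply, fanoutFn_apply, allFn_boolPair ((oneBit_allFn oneBit_invItem).comp _)]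
  simp only [id, nthF13_mkG, idxList, forall_decNil_idxList, Function.comp_apply, fanoutFn_apply, fstF_boolPair,
    allFn_boolPair oneBit_invItem]
  set G := mkG Y (encodeNat n) (matCode B) tn NN Un (matCode W) (dpEnc δ) mm Rtn ys num den (encList ((List.range n).map ones)) gn
  have e : (∀ i, i < n → [decide (∀ k, k < n → invItem (boolPair (boolPair G (ones i)) (ones k)) = [true])] = [true]) ↔
      (∀ i k : Fin n, ∑ l, B i l * W k l = if i = k then δ else 0) := by
    constructor
    · intro h i k
      have h1 := h i i.isLt
      simp only [List.cons.injEq, and_true, decide_eq_true_eq] at h1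
      have h2 := h1 k k.isLt
      rw [invItem_apply Y tn NN Un mm Rtn ys num den _ gn hn B W δ i k] at h2
      simpa using h2
    · intro h i hi
      simp only [List.cons.injEq, and_true, decide_eq_true_eq]
      intro k hk
      have := invItem_apply Y tn NN Un mm Rtn ys num den (encList ((List.range n).map ones)) gn hn B W δ ⟨i, hi⟩ ⟨k, hk⟩
      rw [this]
      simpa using h ⟨i, hi⟩ ⟨k, hk⟩
  simp only [e]


/-! ### All pairs of indices -/

/-- **All pairs test** on `G` for an item `c` on `⟨⟨G, 1ⁱ⟩, 1ᵏ⟩`: `[∀ i k < n, c = [1]]` (nested `allFn`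
over the index list in field `13`). [folklore] -/
noncomputable def pairsAllF (c : List Bool → List Bool) : List Bool → List Bool :=
  allFn (allFn c ∘ fanoutFn id (nthF 13 ∘ fstF)) ∘ fanoutFn id (nthF 13)

/-- `pairsAllF c ∈ FP`. [folklore] -/
theorem pairsAllF_mem_FP {c : List Bool → List Bool} (hc : c ∈ FP) (h1 : OneBit c) : pairsAllF c ∈ FP :=
  comp_mem_FP (allFn_mem_FP (comp_mem_FP (allFn_mem_FP hc h1) (fanoutFn_mem_FP id_mem_FP (comp_mem_FP (nthF_mem_FP 13) fstF_mem_FP)))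
    ((oneBit_allFn h1).comp _)) (fanoutFn_mem_FP id_mem_FP (nthF_mem_FP 13))

/-- `pairsAllF c` is one-bit. [folklore] -/
theorem oneBit_pairsAllF (c : List Bool → List Bool) (h1 : OneBit c) : OneBit (pairsAllF c) :=
  (oneBit_allFn ((oneBit_allFn h1).comp _)).comp _

/-- **Truth of the all-pairs test** on a record whose field `13` is `idxList n`. [folklore] -/
theorem pairsAllF_eq {c : List Bool → List Bool} (h1 : OneBit c) {n : ℕ} {G : List Bool} (hG : nthF 13 G = idxList n)
    (P : Fin n → Fin n → Prop) [∀ i k, Decidable (P i k)]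
    (hc : ∀ i k : Fin n, c (boolPair (boolPair G (ones i)) (ones k)) = [decide (P i k)]) :
    pairsAllF c G = [decide (∀ i k : Fin n, P i k)] := by
  rw [pairsAllF, Function.comp_apply, fanoutFn_apply, allFn_boolPair ((oneBit_allFn h1).comp _)]
  simp only [id, hG, idxList, forall_decNil_idxList, Function.comp_apply, fanoutFn_apply, fstF_boolPair, allFn_boolPair h1]
  have e : (∀ i, i < n → [decide (∀ k, k < n → c (boolPair (boolPair G (ones i)) (ones k)) = [true])] = [true]) ↔
      (∀ i k : Fin n, P i k) := by
    constructor
    · intro h i k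
      have h1 := h i i.isLt
      simp only [List.cons.injEq, and_true, decide_eq_true_eq] at h1
      have h2 := h1 k k.isLt
      rw [hc i k] at h2
      simpa using h2
    · intro h i hi
      simp only [List.cons.injEq, and_true, decide_eq_true_eq]
      intro k hk
      rw [show i = ((⟨i, hi⟩ : Fin n) : ℕ) from rfl, show k = ((⟨k, hk⟩ : Fin n) : ℕ) from rfl, hc]
      simpa using h ⟨i, hi⟩ ⟨k, hk⟩
  simp only [e]

/-- **Semantics of `dotRowsF`** on a test record, from its fields. [folklore] -/
theorem dotRowsF_eq {c p q : ℕ} {r Y : List Bool} {M n₁ n₂ : ℕ} {P : Fin n₁ → Fin M → ℤ} {Q : Fin n₂ → Fin M → ℤ}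
    (h0 : nthF 0 (rG r) = Y) (hcM : nthF c (rG r) = encodeNat M) (hp : nthF p (rG r) = matCode P) (hq : nthF q (rG r) = matCode Q)
    {i : Fin n₁} {k : Fin n₂} (ha : rA r = ones i) (hb : rB r = ones k) (hM : M ≤ Y.length) (hi : (i : ℕ) ≤ Y.length)
    (hk : (k : ℕ) ≤ Y.length) :
    dotRowsF c p q r = dpEnc (∑ t, P i t * Q k t) := by
  simp only [dotRowsF, Function.comp_apply, fanoutFn_apply, h0, hcM, hp, hq, ha, hb, lenBinF_apply, List.length_replicate]
  rw [nthLF_matCode Y i.isLt hi, nthLF_matCode Y k.isLt hk, dotF_apply Y hM]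

/-! ### Test (d): `σ² Q = RᵀR` -/

/-- The integer code of the numeral in a field: `⟨u, ε⟩`, of value `⟦u⟧`. [folklore] -/
noncomputable def numZ (f : List Bool → List Bool) : List Bool → List Bool := fanoutFn f (fun _ => [])

/-- `numZ f ∈ FP`. [folklore] -/
theorem numZ_mem_FP {f : List Bool → List Bool} (hf : f ∈ FP) : numZ f ∈ FP := fanoutFn_mem_FP hf (const_mem_FP _)

/-- Value of `numZ`. [folklore] -/
@[simp] theorem ival_numZ (f : List Bool → List Bool) (z : List Bool) : ival (numZ f z) = bitsToNat (f z) := by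
  simp [numZ]

/-- The test item of (d) on `⟨⟨G, 1ⁱ⟩, 1ᵏ⟩`:
`[σ² (N den² (b_i · b_k) − 20000 num² (u_i · u_k)) − rt_i · rt_k = 0]`. [cite: AharonovRegev2005, §6 test (c) — integer certificate form] -/
noncomputable def momItem : List Bool → List Bool :=
  isZeroFn ∘ zsubF ∘ fanoutFn
    (zmulF ∘ fanoutFn (zmulF ∘ fanoutFn (numZ (nthF 10 ∘ rG)) (numZ (nthF 10 ∘ rG)))
      (zsubF ∘ fanoutFn
        (zmulF ∘ fanoutFn (zmulF ∘ fanoutFn (numZ (nthF 4 ∘ rG)) (zmulF ∘ fanoutFn (numZ (nthF 12 ∘ rG)) (numZ (nthF 12 ∘ rG))))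
          (dotRowsF 1 2 2))
        (zmulF ∘ fanoutFn (zmulF ∘ fanoutFn (fun _ => dpEnc 20000) (zmulF ∘ fanoutFn (numZ (nthF 11 ∘ rG)) (numZ (nthF 11 ∘ rG))))
          (dotRowsF 4 5 5))))
    (dotRowsF 8 9 9)

/-- `momItem ∈ FP`. [folklore] -/
theorem momItem_mem_FP : momItem ∈ FP := by
  have h10 := numZ_mem_FP (comp_mem_FP (nthF_mem_FP 10) rG_mem_FP)
  have h4 := numZ_mem_FP (comp_mem_FP (nthF_mem_FP 4) rG_mem_FP)
  have h12 := numZ_mem_FP (comp_mem_FP (nthF_mem_FP 12) rG_mem_FP)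
  have h11 := numZ_mem_FP (comp_mem_FP (nthF_mem_FP 11) rG_mem_FP)
  exact comp_mem_FP isZeroFn_mem_FP (comp_mem_FP zsubF_mem_FP (fanoutFn_mem_FP
    (comp_mem_FP zmulF_mem_FP (fanoutFn_mem_FP (comp_mem_FP zmulF_mem_FP (fanoutFn_mem_FP h10 h10))
      (comp_mem_FP zsubF_mem_FP (fanoutFn_mem_FP
        (comp_mem_FP zmulF_mem_FP (fanoutFn_mem_FP (comp_mem_FP zmulF_mem_FP (fanoutFn_mem_FP h4 (comp_mem_FP zmulF_mem_FP (fanoutFn_mem_FP h12 h12))))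
          (dotRowsF_mem_FP 1 2 2)))
        (comp_mem_FP zmulF_mem_FP (fanoutFn_mem_FP (comp_mem_FP zmulF_mem_FP (fanoutFn_mem_FP (const_mem_FP _) (comp_mem_FP zmulF_mem_FP (fanoutFn_mem_FP h11 h11))))
          (dotRowsF_mem_FP 4 5 5)))))))
    (dotRowsF_mem_FP 8 9 9)))

/-- `momItem` is one-bit. [folklore] -/
theorem oneBit_momItem : OneBit momItem := oneBit_isZeroFn.comp _

/-- **Truth of the test item of (d)**. [folklore] -/
theorem momItem_apply {n N' m' : ℕ} (Y tn Wn dd ys num den idx gn : List Bool) (hn : n ≤ Y.length) (hN : N' ≤ Y.length)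
    (hm : m' ≤ Y.length) (B : Fin n → Fin n → ℤ) (U : Fin n → Fin N' → ℤ) (Rt : Fin n → Fin m' → ℤ) (i k : Fin n) :
    momItem (boolPair (boolPair (mkG Y (encodeNat n) (matCode B) tn (encodeNat N') (matCode U) Wn dd (encodeNat m') (matCode Rt)
        ys num den idx gn) (ones i)) (ones k)) =
      [decide (((bitsToNat ys : ℤ) * bitsToNat ys) *
          (((N' : ℤ) * ((bitsToNat den : ℤ) * bitsToNat den)) * ∑ l, B i l * B k l -
            (20000 * ((bitsToNat num : ℤ) * bitsToNat num)) * ∑ j, U i j * U k j) -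
          ∑ r, Rt i r * Rt k r = 0)] := by
  have hi : (i : ℕ) ≤ Y.length := le_trans i.isLt.le hn
  have hk : (k : ℕ) ≤ Y.length := le_trans k.isLt.le hn
  set r := boolPair (boolPair (mkG Y (encodeNat n) (matCode B) tn (encodeNat N') (matCode U) Wn dd (encodeNat m') (matCode Rt)
    ys num den idx gn) (ones i)) (ones k) with hr
  have hG : rG r = mkG Y (encodeNat n) (matCode B) tn (encodeNat N') (matCode U) Wn dd (encodeNat m') (matCode Rt) ys num den idx gn := by
    simp [hr, rG]
  have ha : rA r = ones i := by simp [hr, rA]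
  have hb : rB r = ones k := by simp [hr, rB]
  have d1 : dotRowsF 1 2 2 r = dpEnc (∑ l, B i l * B k l) :=
    dotRowsF_eq (by rw [hG, nthF0_mkG]) (by rw [hG, nthF1_mkG]) (by rw [hG, nthF2_mkG]) (by rw [hG, nthF2_mkG]) ha hb hn hi hk
  have d2 : dotRowsF 4 5 5 r = dpEnc (∑ j, U i j * U k j) :=
    dotRowsF_eq (by rw [hG, nthF0_mkG]) (by rw [hG, nthF4_mkG]) (by rw [hG, nthF5_mkG]) (by rw [hG, nthF5_mkG]) ha hb hN hi hk
  have d3 : dotRowsF 8 9 9 r = dpEnc (∑ r, Rt i r * Rt k r) :=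
    dotRowsF_eq (by rw [hG, nthF0_mkG]) (by rw [hG, nthF8_mkG]) (by rw [hG, nthF9_mkG]) (by rw [hG, nthF9_mkG]) ha hb hm hi hk
  simp only [momItem, Function.comp_apply, fanoutFn_apply, d1, d2, d3, zmulF_boolPair, zsubF_boolPair, ival_numZ, ival_dpEnc,
    hG, nthF10_mkG, nthF4_mkG, nthF12_mkG, nthF11_mkG, bitsToNat_encodeNat, isZeroFn_apply]

/-! ### Test (c): the far count -/

/-- The piece of the count on `⟨G, 1ʲ⟩`: the far bit of the phase `col_j(U) · g`. [cite: AharonovRegev2005, §6 test (a)] -/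
noncomputable def phasePiece : List Bool → List Bool :=
  farBitF ∘ fanoutFn (nthF 7 ∘ fstF) (dotF ∘ fanoutFn (nthF 0 ∘ fstF) (fanoutFn (nthF 1 ∘ fstF)
    (fanoutFn (colF ∘ fanoutFn (nthF 0 ∘ fstF) (fanoutFn (nthF 1 ∘ fstF) (fanoutFn (lenBinF ∘ sndF) (nthF 5 ∘ fstF))))
      (sndPow 13 ∘ fstF))))

/-- `phasePiece ∈ FP`. [folklore] -/
theorem phasePiece_mem_FP : phasePiece ∈ FP :=
  comp_mem_FP farBitF_mem_FP (fanoutFn_mem_FP (comp_mem_FP (nthF_mem_FP 7) fstF_mem_FP) (comp_mem_FP dotF_mem_FP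
    (fanoutFn_mem_FP (comp_mem_FP (nthF_mem_FP 0) fstF_mem_FP) (fanoutFn_mem_FP (comp_mem_FP (nthF_mem_FP 1) fstF_mem_FP)
      (fanoutFn_mem_FP (comp_mem_FP colF_mem_FP (fanoutFn_mem_FP (comp_mem_FP (nthF_mem_FP 0) fstF_mem_FP)
        (fanoutFn_mem_FP (comp_mem_FP (nthF_mem_FP 1) fstF_mem_FP) (fanoutFn_mem_FP (comp_mem_FP lenBinF_mem_FP sndF_mem_FP)
          (comp_mem_FP (nthF_mem_FP 5) fstF_mem_FP))))) (comp_mem_FP (sndPow_mem_FP 13) fstF_mem_FP))))))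

/-- `phasePiece` is one-bit. [folklore] -/
theorem oneBit_phasePiece : OneBit phasePiece := oneBit_farBitF.comp _

/-- The far property of the `j`-th phase, as the machine tests it. [folklore] -/
def FarPhase {n N' : ℕ} (U : Fin n → Fin N' → ℤ) (g : Fin n → ℤ) (δ : ℤ) (j : Fin N') : Prop :=
  (δ.natAbs : ℤ) ≤ 8 * ((∑ i, U i j * g i) % δ.natAbs) ∧ (δ.natAbs : ℤ) ≤ 8 * (δ.natAbs - (∑ i, U i j * g i) % δ.natAbs)

/-- `FarPhase` is decidable. [folklore] -/
instance {n N' : ℕ} (U : Fin n → Fin N' → ℤ) (g : Fin n → ℤ) (δ : ℤ) : DecidablePred (FarPhase U g δ) :=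
  fun _ => inferInstanceAs (Decidable (_ ∧ _))

/-- **Truth of the phase piece**. [folklore] -/
theorem phasePiece_apply {n N' : ℕ} (Y Bn tn Wn mm Rtn ys num den idx : List Bool) (hn : n ≤ Y.length) (hN : N' ≤ Y.length)
    (U : Fin n → Fin N' → ℤ) (g : Fin n → ℤ) (δ : ℤ) (j : Fin N') :
    phasePiece (boolPair (mkG Y (encodeNat n) Bn tn (encodeNat N') (matCode U) Wn (dpEnc δ) mm Rtn ys num den idx (rowCode g)) (ones j)) =
      [decide (FarPhase U g δ j)] := by
  have hj : (j : ℕ) ≤ Y.length := le_trans j.isLt.le hN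
  simp only [phasePiece, Function.comp_apply, fanoutFn_apply, fstF_boolPair, sndF_boolPair, nthF7_mkG, nthF0_mkG, nthF1_mkG,
    nthF5_mkG, sndPow13_mkG, lenBinF_apply, List.length_replicate]
  rw [colF_matCode Y hn j.isLt hj, dotF_apply Y hn, farBitF_dpEnc]
  rfl

/-- **The far count** on `G`: `bin #{j < N : far_j}` (indexed fold with addition of the phase pieces).
[cite: AharonovRegev2005, §6 test (a) — counting form] -/
noncomputable def farCntF : List Bool → List Bool :=
  sndPow 2 ∘ foldLoop addFn (clipF 1 phasePiece) X ∘ fanoutFn id (fanoutFn (nthF 4) (fun _ => boolPair [] []))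

/-- `farCntF ∈ FP`. [folklore] -/
theorem cntF_mem_FP : farCntF ∈ FP :=
  comp_mem_FP (sndPow_mem_FP 2) (comp_mem_FP (foldLoop_clipF_mem_FP 1 addFn_mem_FP length_addFn_le phasePiece_mem_FP X)
    (fanoutFn_mem_FP id_mem_FP (fanoutFn_mem_FP (nthF_mem_FP 4) (const_mem_FP _))))

/-- The value of a bit as a numeral. [folklore] -/
theorem bitsToNat_decide (P : Prop) [Decidable P] : bitsToNat [decide P] = if P then 1 else 0 := by
  by_cases h : P <;> simp [h]

/-- The yardstick is a prefix-sized part of `G`. [folklore] -/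
theorem length_le_length_mkG (Y nn Bn tn NN Un Wn dd mm Rtn ys num den idx gn : List Bool) :
    Y.length ≤ (mkG Y nn Bn tn NN Un Wn dd mm Rtn ys num den idx gn).length := by
  rw [mkG, length_boolPair]; omega

/-- **Truth of the far count**. [folklore] -/
theorem cntF_apply {n N' : ℕ} (Y Bn tn Wn mm Rtn ys num den idx : List Bool) (hn : n ≤ Y.length) (hN : N' ≤ Y.length)
    (U : Fin n → Fin N' → ℤ) (g : Fin n → ℤ) (δ : ℤ) :
    farCntF (mkG Y (encodeNat n) Bn tn (encodeNat N') (matCode U) Wn (dpEnc δ) mm Rtn ys num den idx (rowCode g)) =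
      encodeNat ((Finset.univ.filter (FarPhase U g δ)).card) := by
  set G := mkG Y (encodeNat n) Bn tn (encodeNat N') (matCode U) Wn (dpEnc δ) mm Rtn ys num den idx (rowCode g) with hGdef
  have hNG : N' ≤ X.eval G.length := by
    rw [eval_X]; exact hN.trans (length_le_length_mkG _ _ _ _ _ _ _ _ _ _ _ _ _ _ _)
  have h0 : boolPair [] [] = boolPair (ones 0) (encodeNat 0) := rfl
  rw [farCntF, Function.comp_apply, Function.comp_apply, fanoutFn_apply, fanoutFn_apply, id, show nthF 4 G = encodeNat N' by rw [hGdef, nthF4_mkG],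
    h0, foldLoop_apply _ _ hNG, sndPow_succ_boolPair, sndPow_succ_boolPair, sndPow_zero_boolPair,
    foldAcc_clipF (fun j _ _ => by rw [oneBit_phasePiece.length_eq]; omega), foldAcc_addFn]
  congr 1
  rw [Nat.zero_add, Finset.card_eq_sum_ones, Finset.sum_filter, ← Fin.sum_univ_eq_sum_range]
  refine Finset.sum_congr rfl fun j _ => ?_
  rw [Nat.zero_add, hGdef, phasePiece_apply Y Bn tn Wn mm Rtn ys num den idx hn hN U g δ j, bitsToNat_decide]

/-! ### All tests -/

/-- **The conjunction of the tests** on `G`: `δ ≠ 0`, (b), `σ ≠ 0`, (d), `N < 4 · #far`.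
[cite: AharonovRegev2005, §6 (p. 10, tests (a)–(c)) — integer certificate form] -/
noncomputable def testsF : List Bool → List Bool :=
  andFn (notFn (isZeroFn ∘ nthF 7)) (andFn (pairsAllF invItem) (andFn (ltFn ∘ fanoutFn (fun _ => []) (nthF 10))
    (andFn (pairsAllF momItem) (ltFn ∘ fanoutFn (nthF 4) (prodFn ∘ fanoutFn (fun _ => encodeNat 4) farCntF)))))

/-- `testsF ∈ FP`. [folklore] -/
theorem testsF_mem_FP : testsF ∈ FP :=
  andFn_mem_FP (notFn_mem_FP (comp_mem_FP isZeroFn_mem_FP (nthF_mem_FP 7))) (andFn_mem_FP (pairsAllF_mem_FP invItem_mem_FP oneBit_invItem)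
    (andFn_mem_FP (comp_mem_FP ltFn_mem_FP (fanoutFn_mem_FP (const_mem_FP _) (nthF_mem_FP 10)))
      (andFn_mem_FP (pairsAllF_mem_FP momItem_mem_FP oneBit_momItem) (comp_mem_FP ltFn_mem_FP (fanoutFn_mem_FP (nthF_mem_FP 4)
        (comp_mem_FP prodFn_mem_FP (fanoutFn_mem_FP (const_mem_FP _) cntF_mem_FP)))))))

/-- `testsF` is one-bit. [folklore] -/
theorem oneBit_testsF : OneBit testsF :=
  oneBit_andFn (oneBit_notFn (oneBit_isZeroFn.comp _)) (oneBit_andFn (oneBit_pairsAllF _ oneBit_invItem)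
    (oneBit_andFn (oneBit_ltFn.comp _) (oneBit_andFn (oneBit_pairsAllF _ oneBit_momItem) (oneBit_ltFn.comp _))))

/-- **Truth of the tests** on a record of genuine codes. [folklore] -/
theorem testsF_apply {n N' m' : ℕ} (Y ys num den : List Bool) (hn : n ≤ Y.length) (hN : N' ≤ Y.length) (hm : m' ≤ Y.length)
    (B W : Fin n → Fin n → ℤ) (t : Fin n → ℤ) (U : Fin n → Fin N' → ℤ) (Rt : Fin n → Fin m' → ℤ) (g : Fin n → ℤ) (δ : ℤ) :
    testsF (mkG Y (encodeNat n) (matCode B) (rowCode t) (encodeNat N') (matCode U) (matCode W) (dpEnc δ) (encodeNat m') (matCode Rt)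
        ys num den (idxList n) (rowCode g)) =
      [decide (δ ≠ 0 ∧ (∀ i k : Fin n, ∑ l, B i l * W k l = if i = k then δ else 0) ∧ 0 < bitsToNat ys ∧
        (∀ i k : Fin n, ((bitsToNat ys : ℤ) * bitsToNat ys) *
          (((N' : ℤ) * ((bitsToNat den : ℤ) * bitsToNat den)) * ∑ l, B i l * B k l -
            (20000 * ((bitsToNat num : ℤ) * bitsToNat num)) * ∑ j, U i j * U k j) -
          ∑ r, Rt i r * Rt k r = 0) ∧
        N' < 4 * (Finset.univ.filter (FarPhase U g δ)).card)] := by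
  set G := mkG Y (encodeNat n) (matCode B) (rowCode t) (encodeNat N') (matCode U) (matCode W) (dpEnc δ) (encodeNat m') (matCode Rt)
    ys num den (idxList n) (rowCode g) with hGdef
  have t1 : (notFn (isZeroFn ∘ nthF 7)) G = [decide (δ ≠ 0)] := by
    rw [notFn_apply (show (isZeroFn ∘ nthF 7) G = [decide (δ = 0)] by simp [hGdef])]
    simp
  have t2 : pairsAllF invItem G = [decide (∀ i k : Fin n, ∑ l, B i l * W k l = if i = k then δ else 0)] :=
    pairsAllF_eq oneBit_invItem (by rw [hGdef, nthF13_mkG]) _ fun i k => by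
      rw [hGdef]; exact invItem_apply Y (rowCode t) (encodeNat N') (matCode U) (encodeNat m') (matCode Rt) ys num den (idxList n) (rowCode g) hn B W δ i k
  have t3 : (Brick.ltFn ∘ fanoutFn (fun _ => []) (nthF 10)) G = [decide (0 < bitsToNat ys)] := by simp [hGdef]
  have t4 : pairsAllF momItem G = [decide (∀ i k : Fin n, ((bitsToNat ys : ℤ) * bitsToNat ys) *
          (((N' : ℤ) * ((bitsToNat den : ℤ) * bitsToNat den)) * ∑ l, B i l * B k l -
            (20000 * ((bitsToNat num : ℤ) * bitsToNat num)) * ∑ j, U i j * U k j) -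
          ∑ r, Rt i r * Rt k r = 0)] :=
    pairsAllF_eq oneBit_momItem (by rw [hGdef, nthF13_mkG]) _ fun i k => by
      rw [hGdef]; exact momItem_apply Y (rowCode t) (matCode W) (dpEnc δ) ys num den (idxList n) (rowCode g) hn hN hm B U Rt i k
  have t5 : (Brick.ltFn ∘ fanoutFn (nthF 4) (prodFn ∘ fanoutFn (fun _ => encodeNat 4) farCntF)) G =
      [decide (N' < 4 * (Finset.univ.filter (FarPhase U g δ)).card)] := by
    simp only [Function.comp_apply, fanoutFn_apply, hGdef, nthF4_mkG,
      cntF_apply Y (matCode B) (rowCode t) (matCode W) (encodeNat m') (matCode Rt) ys num den (idxList n) hn hN U g δ,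
      prodFn_boolPair, bitsToNat_encodeNat, ltFn_boolPair]
  rw [testsF, andFn_apply t1 (andFn_apply t2 (andFn_apply t3 (andFn_apply t4 t5)))]
  simp only [Bool.decide_and]

/-! ### The vector `g = t C` (capped) -/

/-- The item of `g` on `⟨Y, ⟨⟨bin n, tn⟩, w_k⟩⟩`: `zcapF ⟨Y, w_k · t⟩`. [folklore] -/
noncomputable def gItem : List Bool → List Bool :=
  zcapF ∘ fanoutFn (nthF 0) (dotF ∘ fanoutFn (nthF 0) (fanoutFn (fstF ∘ nthF 1) (fanoutFn (sndPow 1) (sndF ∘ nthF 1))))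

/-- `gItem ∈ FP`. [folklore] -/
theorem gItem_mem_FP : gItem ∈ FP :=
  comp_mem_FP zcapF_mem_FP (fanoutFn_mem_FP (nthF_mem_FP 0) (comp_mem_FP dotF_mem_FP (fanoutFn_mem_FP (nthF_mem_FP 0)
    (fanoutFn_mem_FP (comp_mem_FP fstF_mem_FP (nthF_mem_FP 1)) (fanoutFn_mem_FP (sndPow_mem_FP 1) (comp_mem_FP sndF_mem_FP (nthF_mem_FP 1)))))))

/-- Semantics of `gItem` (`n ≤ |Y|`). [folklore] -/
theorem gItem_apply (Y : List Bool) {n : ℕ} (hn : n ≤ Y.length) (t w : Fin n → ℤ) :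
    gItem (boolPair Y (boolPair (boolPair (encodeNat n) (rowCode t)) (rowCode w))) = dpEnc (capZ Y.length (∑ l, w l * t l)) := by
  simp only [gItem, Function.comp_apply, fanoutFn_apply, nthF_zero_boolPair, nthF_succ_boolPair, sndPow_succ_boolPair, sndPow_zero,
    sndF_boolPair, fstF_boolPair]
  rw [dotF_apply Y hn, zcapF_dpEnc, capZ]

/-- `gItem` saturates: `≤ 2|Y| + 2`. [folklore] -/
theorem length_gItem_le (x p a : List Bool) :
    (gItem (boolPair x (boolPair p a))).length ≤ 0 * a.length + (2 * X + 2 : Polynomial ℕ).eval x.length := by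
  have := length_zcapF_le (boolPair x (dotF (boolPair x (boolPair (fstF p) (boolPair a (sndF p))))))
  simp only [gItem, Function.comp_apply, fanoutFn_apply, nthF_zero_boolPair, nthF_succ_boolPair, sndPow_succ_boolPair, sndPow_zero,
    sndF_boolPair, fstF_boolPair, eval_add, eval_mul, eval_ofNat, eval_X, zero_mul, zero_add] at this ⊢
  exact this

/-- **The vector `g = t C`** (capped at width `|Y|`) on `⟨Y, ⟨bin n, ⟨⟨bin n, tn⟩, Wn⟩⟩⟩`: the map of `gItem`
over the rows `w_k` of `W = Cᵀ` (`g_k = ∑ₗ W_{kl} tₗ = (t C)_k`). [cite: AharonovRegev2005, §6 test (a)] -/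
noncomputable def gVecF : List Bool → List Bool := mapLF gItem

/-- `gVecF ∈ FP`. [folklore] -/
theorem gVecF_mem_FP : gVecF ∈ FP := mapLF_mem_FP gItem_mem_FP (w := 0) (by norm_num) length_gItem_le

/-- `rowCode` as a coded `ofFn`. [folklore] -/
theorem rowCode_eq_ofFn {m : ℕ} (v : Fin m → ℤ) : rowCode v = encList (List.ofFn fun k => dpEnc (v k)) := by
  rw [rowCode, zlist_eq, List.map_ofFn]; rfl

/-- Semantics of `gVecF`. [folklore] -/
theorem gVecF_apply (Y : List Bool) {n : ℕ} (hn : n ≤ Y.length) (t : Fin n → ℤ) (W : Fin n → Fin n → ℤ) :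
    gVecF (boolPair Y (boolPair (encodeNat n) (boolPair (boolPair (encodeNat n) (rowCode t)) (matCode W)))) =
      rowCode (fun k : Fin n => capZ Y.length (∑ l, W k l * t l)) := by
  rw [gVecF, matCode, mapLF_apply _ _ _ hn, List.take_of_length_le (by simp), List.map_ofFn,
    rowCode_eq_ofFn (fun k : Fin n => capZ Y.length (∑ l, W k l * t l))]
  refine congrArg encList (congrArg List.ofFn (funext fun k => ?_))
  simp only [Function.comp_apply]
  exact gItem_apply Y hn t (W k)

/-! ### From the input `w = ⟨x, y⟩` to the record `G` -/

/-- The yardstick `Y = w ++ w ++ w`. [folklore] -/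
def yardW : List Bool → List Bool := fun w => w ++ (w ++ w)
/-- `yardW ∈ FP`. [folklore] -/
theorem yardW_mem_FP : yardW ∈ FP := append_mem_FP id_mem_FP (append_mem_FP id_mem_FP id_mem_FP)
/-- Length of the yardstick. [folklore] -/
@[simp] theorem length_yardW (w : List Bool) : (yardW w).length = 3 * w.length := by simp [yardW]; ring

/-- The dimension numeral `bin n` of the instance. [folklore] -/
def ncW : List Bool → List Bool := fstF ∘ fstF ∘ fstF
/-- The entry list of the basis. [folklore] -/
def entsW : List Bool → List Bool := sndF ∘ fstF ∘ sndF ∘ fstF ∘ fstF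
/-- The entry list of the target. [folklore] -/
def tentsW : List Bool → List Bool := sndF ∘ sndF ∘ sndF ∘ fstF ∘ fstF
/-- The numeral `bin |num d|`. [folklore] -/
def numW : List Bool → List Bool := sndF ∘ fstF ∘ sndF ∘ fstF
/-- The numeral `bin (den d)`. [folklore] -/
def denW : List Bool → List Bool := sndF ∘ sndF ∘ fstF
/-- Witness field `i` (`0 ≤ i ≤ 5`). [folklore] -/
def yfW (i : ℕ) : List Bool → List Bool := nthF i ∘ sndF
/-- The last witness field `yσ`. [folklore] -/
def ysW : List Bool → List Bool := sndPow 5 ∘ sndF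

/-- `ncW ∈ FP`. [folklore] -/
theorem ncW_mem_FP : ncW ∈ FP := comp_mem_FP fstF_mem_FP (comp_mem_FP fstF_mem_FP fstF_mem_FP)
/-- `entsW ∈ FP`. [folklore] -/
theorem entsW_mem_FP : entsW ∈ FP :=
  comp_mem_FP sndF_mem_FP (comp_mem_FP fstF_mem_FP (comp_mem_FP sndF_mem_FP (comp_mem_FP fstF_mem_FP fstF_mem_FP)))
/-- `tentsW ∈ FP`. [folklore] -/
theorem tentsW_mem_FP : tentsW ∈ FP :=
  comp_mem_FP sndF_mem_FP (comp_mem_FP sndF_mem_FP (comp_mem_FP sndF_mem_FP (comp_mem_FP fstF_mem_FP fstF_mem_FP)))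
/-- `numW ∈ FP`. [folklore] -/
theorem numW_mem_FP : numW ∈ FP := comp_mem_FP sndF_mem_FP (comp_mem_FP fstF_mem_FP (comp_mem_FP sndF_mem_FP fstF_mem_FP))
/-- `denW ∈ FP`. [folklore] -/
theorem denW_mem_FP : denW ∈ FP := comp_mem_FP sndF_mem_FP (comp_mem_FP sndF_mem_FP fstF_mem_FP)
/-- `yfW i ∈ FP`. [folklore] -/
theorem yfW_mem_FP (i : ℕ) : yfW i ∈ FP := comp_mem_FP (nthF_mem_FP i) sndF_mem_FP
/-- `ysW ∈ FP`. [folklore] -/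
theorem ysW_mem_FP : ysW ∈ FP := comp_mem_FP (sndPow_mem_FP 5) sndF_mem_FP

/-- The index list `idxList n`. [folklore] -/
noncomputable def idxnW : List Bool → List Bool := iotaF ∘ fanoutFn yardW ncW
/-- The capped sample count `bin N'`, `N' = min ⟦yN⟧ |Y|`. [folklore] -/
noncomputable def NbinW : List Bool → List Bool := lenBinF ∘ binToUnaryFn ∘ fanoutFn yardW (yfW 0)
/-- The index list `idxList N'`. [folklore] -/
noncomputable def idxNW : List Bool → List Bool := iotaF ∘ fanoutFn yardW NbinW
/-- The capped row count `bin m'`. [folklore] -/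
noncomputable def MbinW : List Bool → List Bool := lenBinF ∘ binToUnaryFn ∘ fanoutFn yardW (yfW 4)
/-- The index list `idxList m'`. [folklore] -/
noncomputable def idxMW : List Bool → List Bool := iotaF ∘ fanoutFn yardW MbinW
/-- The normalised basis. [folklore] -/
noncomputable def BnW : List Bool → List Bool :=
  bMatF ∘ fanoutFn yardW (fanoutFn ncW (fanoutFn (fanoutFn ncW (fanoutFn entsW idxnW)) idxnW))
/-- The normalised target. [folklore] -/
noncomputable def tnW : List Bool → List Bool := tRowF ∘ fanoutFn yardW (fanoutFn ncW (fanoutFn tentsW idxnW))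
/-- The normalised samples (transposed: `n` rows of length `N'`). [folklore] -/
noncomputable def UnW : List Bool → List Bool :=
  normMatF ∘ fanoutFn yardW (fanoutFn ncW (fanoutFn (fanoutFn NbinW (fanoutFn idxNW (yfW 1))) idxnW))
/-- The normalised inverse (transposed). [folklore] -/
noncomputable def WnW : List Bool → List Bool :=
  normMatF ∘ fanoutFn yardW (fanoutFn ncW (fanoutFn (fanoutFn ncW (fanoutFn idxnW (yfW 2))) idxnW))
/-- The normalised certificate (transposed: `n` rows of length `m'`). [folklore] -/
noncomputable def RtnW : List Bool → List Bool :=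
  normMatF ∘ fanoutFn yardW (fanoutFn ncW (fanoutFn (fanoutFn MbinW (fanoutFn idxMW (yfW 5))) idxnW))
/-- The canonical code of `δ`. [folklore] -/
noncomputable def ddW : List Bool → List Bool := zcanonF ∘ yfW 3
/-- The vector `g`. [folklore] -/
noncomputable def gnW : List Bool → List Bool := gVecF ∘ fanoutFn yardW (fanoutFn ncW (fanoutFn (fanoutFn ncW tnW) WnW))

/-- `idxnW ∈ FP`. [folklore] -/
theorem idxnW_mem_FP : idxnW ∈ FP := comp_mem_FP iotaF_mem_FP (fanoutFn_mem_FP yardW_mem_FP ncW_mem_FP)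
/-- `NbinW ∈ FP`. [folklore] -/
theorem NbinW_mem_FP : NbinW ∈ FP :=
  comp_mem_FP lenBinF_mem_FP (comp_mem_FP binToUnaryFn_mem_FP (fanoutFn_mem_FP yardW_mem_FP (yfW_mem_FP 0)))
/-- `idxNW ∈ FP`. [folklore] -/
theorem idxNW_mem_FP : idxNW ∈ FP := comp_mem_FP iotaF_mem_FP (fanoutFn_mem_FP yardW_mem_FP NbinW_mem_FP)
/-- `MbinW ∈ FP`. [folklore] -/
theorem MbinW_mem_FP : MbinW ∈ FP :=
  comp_mem_FP lenBinF_mem_FP (comp_mem_FP binToUnaryFn_mem_FP (fanoutFn_mem_FP yardW_mem_FP (yfW_mem_FP 4)))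
/-- `idxMW ∈ FP`. [folklore] -/
theorem idxMW_mem_FP : idxMW ∈ FP := comp_mem_FP iotaF_mem_FP (fanoutFn_mem_FP yardW_mem_FP MbinW_mem_FP)
/-- `BnW ∈ FP`. [folklore] -/
theorem BnW_mem_FP : BnW ∈ FP :=
  comp_mem_FP bMatF_mem_FP (fanoutFn_mem_FP yardW_mem_FP (fanoutFn_mem_FP ncW_mem_FP (fanoutFn_mem_FP
    (fanoutFn_mem_FP ncW_mem_FP (fanoutFn_mem_FP entsW_mem_FP idxnW_mem_FP)) idxnW_mem_FP)))
/-- `tnW ∈ FP`. [folklore] -/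
theorem tnW_mem_FP : tnW ∈ FP :=
  comp_mem_FP tRowF_mem_FP (fanoutFn_mem_FP yardW_mem_FP (fanoutFn_mem_FP ncW_mem_FP (fanoutFn_mem_FP tentsW_mem_FP idxnW_mem_FP)))
/-- `UnW ∈ FP`. [folklore] -/
theorem UnW_mem_FP : UnW ∈ FP :=
  comp_mem_FP normMatF_mem_FP (fanoutFn_mem_FP yardW_mem_FP (fanoutFn_mem_FP ncW_mem_FP (fanoutFn_mem_FP
    (fanoutFn_mem_FP NbinW_mem_FP (fanoutFn_mem_FP idxNW_mem_FP (yfW_mem_FP 1))) idxnW_mem_FP)))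
/-- `WnW ∈ FP`. [folklore] -/
theorem WnW_mem_FP : WnW ∈ FP :=
  comp_mem_FP normMatF_mem_FP (fanoutFn_mem_FP yardW_mem_FP (fanoutFn_mem_FP ncW_mem_FP (fanoutFn_mem_FP
    (fanoutFn_mem_FP ncW_mem_FP (fanoutFn_mem_FP idxnW_mem_FP (yfW_mem_FP 2))) idxnW_mem_FP)))
/-- `RtnW ∈ FP`. [folklore] -/
theorem RtnW_mem_FP : RtnW ∈ FP :=
  comp_mem_FP normMatF_mem_FP (fanoutFn_mem_FP yardW_mem_FP (fanoutFn_mem_FP ncW_mem_FP (fanoutFn_mem_FP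
    (fanoutFn_mem_FP MbinW_mem_FP (fanoutFn_mem_FP idxMW_mem_FP (yfW_mem_FP 5))) idxnW_mem_FP)))
/-- `ddW ∈ FP`. [folklore] -/
theorem ddW_mem_FP : ddW ∈ FP := comp_mem_FP zcanonF_mem_FP (yfW_mem_FP 3)
/-- `gnW ∈ FP`. [folklore] -/
theorem gnW_mem_FP : gnW ∈ FP :=
  comp_mem_FP gVecF_mem_FP (fanoutFn_mem_FP yardW_mem_FP (fanoutFn_mem_FP ncW_mem_FP (fanoutFn_mem_FP (fanoutFn_mem_FP ncW_mem_FP tnW_mem_FP) WnW_mem_FP)))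

/-- **The record of normalised data** computed from the input `w = ⟨x, y⟩`. [folklore] -/
noncomputable def prepW : List Bool → List Bool :=
  fanoutFn yardW (fanoutFn ncW (fanoutFn BnW (fanoutFn tnW (fanoutFn NbinW (fanoutFn UnW (fanoutFn WnW (fanoutFn ddW
    (fanoutFn MbinW (fanoutFn RtnW (fanoutFn ysW (fanoutFn numW (fanoutFn denW (fanoutFn idxnW gnW)))))))))))))

/-- `prepW ∈ FP`. [folklore] -/
theorem prepW_mem_FP : prepW ∈ FP :=
  fanoutFn_mem_FP yardW_mem_FP (fanoutFn_mem_FP ncW_mem_FP (fanoutFn_mem_FP BnW_mem_FP (fanoutFn_mem_FP tnW_mem_FP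
    (fanoutFn_mem_FP NbinW_mem_FP (fanoutFn_mem_FP UnW_mem_FP (fanoutFn_mem_FP WnW_mem_FP (fanoutFn_mem_FP ddW_mem_FP
      (fanoutFn_mem_FP MbinW_mem_FP (fanoutFn_mem_FP RtnW_mem_FP (fanoutFn_mem_FP ysW_mem_FP (fanoutFn_mem_FP numW_mem_FP
        (fanoutFn_mem_FP denW_mem_FP (fanoutFn_mem_FP idxnW_mem_FP gnW_mem_FP)))))))))))))

/-- **The verifier**: the tests on the record of normalised data. [cite: AharonovRegev2005, §6 (p. 10)] -/
noncomputable def verifW : List Bool → List Bool := testsF ∘ prepW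

/-- `verifW ∈ FP`. [folklore] -/
theorem verifW_mem_FP : verifW ∈ FP := comp_mem_FP testsF_mem_FP prepW_mem_FP

/-- `verifW` is one-bit. [folklore] -/
theorem oneBit_verifW : OneBit verifW := oneBit_testsF.comp _

/-! ### The input: fields of the instance code and of the witness -/

section Input

variable (I : LatticeInstance) (t : Fin I.n → ℤ) (d : ℚ) (y : List Bool)

/-- The code of the instance `((B, t), d)`. [folklore] -/
noncomputable abbrev codeOf : List Bool := gapCVPInstanceEncoding.encode ((⟨I, t⟩ : CVPInstance), d)

/-- The code of `((B, t), d)`, with the target code unfolded. [folklore] -/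
theorem codeOf_eq : codeOf I t d =
    boolPair (boolPair (encodeNat I.n) (boolPair (boolPair (unaryEncodeNat (I.n * I.n)) (body (rowMajor I.n I.basis)))
      (boolPair (unaryEncodeNat I.n) (frames (List.ofFn fun k => encodingIntBool.encode (t k))))))
      (boolPair (boolPair [decide (d.num < 0)] (encodeNat d.num.natAbs)) (encodeNat d.den)) := by
  rw [codeOf, FarCert.gapCVP_encode_fields, vec_encode_eq]

/-- `ncW ⟨x, y⟩ = bin n`. [folklore] -/
@[simp] theorem ncW_input : ncW (boolPair (codeOf I t d) y) = encodeNat I.n := by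
  rw [codeOf_eq]; simp [ncW]
/-- `entsW ⟨x, y⟩`. [folklore] -/
@[simp] theorem entsW_input : entsW (boolPair (codeOf I t d) y) = body (rowMajor I.n I.basis) := by
  rw [codeOf_eq]; simp [entsW]
/-- `tentsW ⟨x, y⟩`. [folklore] -/
@[simp] theorem tentsW_input : tentsW (boolPair (codeOf I t d) y) = frames (List.ofFn fun k => encodingIntBool.encode (t k)) := by
  rw [codeOf_eq]; simp [tentsW]
/-- `numW ⟨x, y⟩ = bin |num d|`. [folklore] -/
@[simp] theorem numW_input : numW (boolPair (codeOf I t d) y) = encodeNat d.num.natAbs := by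
  rw [codeOf_eq]; simp [numW]
/-- `denW ⟨x, y⟩ = bin (den d)`. [folklore] -/
@[simp] theorem denW_input : denW (boolPair (codeOf I t d) y) = encodeNat d.den := by
  rw [codeOf_eq]; simp [denW]
/-- `yfW i ⟨x, y⟩`. [folklore] -/
@[simp] theorem yfW_input (i : ℕ) : yfW i (boolPair (codeOf I t d) y) = nthF i y := by simp [yfW]
/-- `ysW ⟨x, y⟩`. [folklore] -/
@[simp] theorem ysW_input : ysW (boolPair (codeOf I t d) y) = sndPow 5 y := by simp [ysW]

/-- Sizes of the instance parts against the code length `|x|`: `n`, `n²`, `|ents|`, `|tents|`. [folklore] -/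
theorem sizes_input :
    I.n ≤ (codeOf I t d).length ∧ I.n * I.n ≤ (codeOf I t d).length ∧
      (body (rowMajor I.n I.basis)).length ≤ (codeOf I t d).length ∧
      (frames (List.ofFn fun k => encodingIntBool.encode (t k))).length ≤ (codeOf I t d).length := by
  have hun : (unaryEncodeNat (I.n * I.n)).length = I.n * I.n := Literature.Computability.MetaComplexity.length_unaryEncodeNat _
  have hn := (FarCert.sizes_le_length_encode_gapCVP I t d).1
  refine ⟨hn, ?_, ?_, ?_⟩ <;>
  · rw [codeOf_eq]; simp only [length_boolPair]; omega

end Input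

/-! ### The data decoded from the witness (total) -/

/-- The length bound `L = |Y| = 3 |⟨x, y⟩|` under which counts are capped and values read. [folklore] -/
def Lof (x y : List Bool) : ℕ := 3 * (boolPair x y).length

/-- The decoded sample count `N = min ⟦y₀⟧ L`. [folklore] -/
def dN (L : ℕ) (y : List Bool) : ℕ := min (bitsToNat (nthF 0 y)) L
/-- The decoded samples, transposed: `U k j = ⟦(y₁[k])[j]⟧` (`A = Uᵀ`). [folklore] -/
def dU (n L : ℕ) (y : List Bool) : Fin n → Fin (dN L y) → ℤ := fun k j => ival (elemOf (elemOf (nthF 1 y) k) j)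
/-- The decoded inverse, transposed: `W k l = ⟦(y₂[k])[l]⟧` (`C = Wᵀ`). [folklore] -/
def dW (n : ℕ) (y : List Bool) : Fin n → Fin n → ℤ := fun k l => ival (elemOf (elemOf (nthF 2 y) k) l)
/-- The decoded `δ = ⟦y₃⟧`. [folklore] -/
def dδ (y : List Bool) : ℤ := ival (nthF 3 y)
/-- The decoded row count `m = min ⟦y₄⟧ L`. [folklore] -/
def dM (L : ℕ) (y : List Bool) : ℕ := min (bitsToNat (nthF 4 y)) L
/-- The decoded certificate, transposed: `Rt k r = ⟦(y₅[k])[r]⟧` (`R = Rtᵀ`). [folklore] -/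
def dRt (n L : ℕ) (y : List Bool) : Fin n → Fin (dM L y) → ℤ := fun k r => ival (elemOf (elemOf (nthF 5 y) k) r)
/-- The decoded `σ = ⟦y₆⟧` (the last field, a numeral). [folklore] -/
def dσ (y : List Bool) : ℕ := bitsToNat (sndPow 5 y)
/-- The vector `g = t C`: `g k = ∑ₗ W k l · t l`. [folklore] -/
def dg (n : ℕ) (y : List Bool) (t : Fin n → ℤ) : Fin n → ℤ := fun k => ∑ l, dW n y k l * t l

/-- `|y| ≤ L`, indeed `|⟨x, y⟩| ≤ |Y|`. [folklore] -/
theorem length_le_Lof (x y : List Bool) : (boolPair x y).length ≤ Lof x y := by rw [Lof]; omega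

section Components

variable (I : LatticeInstance) (t : Fin I.n → ℤ) (d : ℚ) (y : List Bool)

/-- The yardstick of the input. [folklore] -/
theorem yardW_input_length : (yardW (boolPair (codeOf I t d) y)).length = Lof (codeOf I t d) y := by
  rw [length_yardW, Lof]

/-- `n ≤ |Y|`. [folklore] -/
theorem n_le_L : I.n ≤ Lof (codeOf I t d) y :=
  (sizes_input I t d).1.trans ((by rw [length_boolPair]; omega : (codeOf I t d).length ≤ (boolPair (codeOf I t d) y).length).trans
    (length_le_Lof _ _))

/-- `|x| ≤ |Y|`. [folklore] -/
theorem length_code_le_L : (codeOf I t d).length ≤ Lof (codeOf I t d) y :=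
  le_trans (by rw [length_boolPair]; omega) (length_le_Lof (codeOf I t d) y)

/-- `|y| ≤ |Y|`. [folklore] -/
theorem length_wit_le_L : y.length ≤ Lof (codeOf I t d) y :=
  le_trans (by rw [length_boolPair]; omega) (length_le_Lof (codeOf I t d) y)

/-- `idxnW` on the input. [folklore] -/
theorem idxnW_input : idxnW (boolPair (codeOf I t d) y) = idxList I.n := by
  rw [idxnW, Function.comp_apply, fanoutFn_apply, ncW_input, iotaF_apply _ (by rw [yardW_input_length]; exact n_le_L I t d y)]

/-- `NbinW` on the input: `bin N`. [folklore] -/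
theorem NbinW_input : NbinW (boolPair (codeOf I t d) y) = encodeNat (dN (Lof (codeOf I t d) y) y) := by
  rw [NbinW, Function.comp_apply, Function.comp_apply, fanoutFn_apply, yfW_input, binToUnaryFn_boolPair, lenBinF_apply,
    yardW_input_length, dN]
  simp [ones]

/-- `idxNW` on the input. [folklore] -/
theorem idxNW_input : idxNW (boolPair (codeOf I t d) y) = idxList (dN (Lof (codeOf I t d) y) y) := by
  rw [idxNW, Function.comp_apply, fanoutFn_apply, NbinW_input, iotaF_apply _ (by rw [yardW_input_length, dN]; exact min_le_right _ _)]

/-- `MbinW` on the input: `bin m`. [folklore] -/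
theorem MbinW_input : MbinW (boolPair (codeOf I t d) y) = encodeNat (dM (Lof (codeOf I t d) y) y) := by
  rw [MbinW, Function.comp_apply, Function.comp_apply, fanoutFn_apply, yfW_input, binToUnaryFn_boolPair, lenBinF_apply,
    yardW_input_length, dM]
  simp [ones]

/-- `idxMW` on the input. [folklore] -/
theorem idxMW_input : idxMW (boolPair (codeOf I t d) y) = idxList (dM (Lof (codeOf I t d) y) y) := by
  rw [idxMW, Function.comp_apply, fanoutFn_apply, MbinW_input, iotaF_apply _ (by rw [yardW_input_length, dM]; exact min_le_right _ _)]

/-- `BnW` on the input: the canonical code of the basis. [folklore] -/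
theorem BnW_input : BnW (boolPair (codeOf I t d) y) = matCode (fun i k : Fin I.n => I.basis i k) := by
  rw [BnW, Function.comp_apply]
  simp only [fanoutFn_apply, ncW_input, entsW_input, idxnW_input]
  exact bMatF_rowMajor _ I.basis (by rw [yardW_input_length]; exact (sizes_input I t d).2.1.trans (length_code_le_L I t d y))
    (by rw [yardW_input_length]; exact (sizes_input I t d).2.2.1.trans (length_code_le_L I t d y))

/-- `tnW` on the input: the canonical code of the target. [folklore] -/
theorem tnW_input : tnW (boolPair (codeOf I t d) y) = rowCode t := by
  rw [tnW, Function.comp_apply]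
  simp only [fanoutFn_apply, ncW_input, tentsW_input, idxnW_input]
  exact tRowF_frames _ (by rw [yardW_input_length]; exact n_le_L I t d y) t
    (by rw [yardW_input_length]; exact (sizes_input I t d).2.2.2.trans (length_code_le_L I t d y))

/-- `UnW` on the input: the canonical code of the decoded samples. [folklore] -/
theorem UnW_input : UnW (boolPair (codeOf I t d) y) = matCode (dU I.n (Lof (codeOf I t d) y) y) := by
  rw [UnW, Function.comp_apply]
  simp only [fanoutFn_apply, ncW_input, NbinW_input, idxNW_input, idxnW_input, yfW_input]
  rw [normMatF_apply _ (by rw [yardW_input_length]; exact n_le_L I t d y) (by rw [yardW_input_length, dN]; exact min_le_right _ _)]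
  refine congrArg matCode (funext fun k => funext fun j => ?_)
  have hv : (elemOf (nthF 1 y) k).length ≤ (yardW (boolPair (codeOf I t d) y)).length := by
    rw [yardW_input_length]
    exact ((length_elemOf_le _ _).trans (length_nthF_le 1 y)).trans (length_wit_le_L I t d y)
  rw [capZ_ival_elemOf hv, dU]

/-- `WnW` on the input. [folklore] -/
theorem WnW_input : WnW (boolPair (codeOf I t d) y) = matCode (dW I.n y) := by
  rw [WnW, Function.comp_apply]
  simp only [fanoutFn_apply, ncW_input, idxnW_input, yfW_input]
  rw [normMatF_apply _ (by rw [yardW_input_length]; exact n_le_L I t d y) (by rw [yardW_input_length]; exact n_le_L I t d y)]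
  refine congrArg matCode (funext fun k => funext fun l => ?_)
  have hv : (elemOf (nthF 2 y) k).length ≤ (yardW (boolPair (codeOf I t d) y)).length := by
    rw [yardW_input_length]
    exact ((length_elemOf_le _ _).trans (length_nthF_le 2 y)).trans (length_wit_le_L I t d y)
  rw [capZ_ival_elemOf hv, dW]

/-- `RtnW` on the input. [folklore] -/
theorem RtnW_input : RtnW (boolPair (codeOf I t d) y) = matCode (dRt I.n (Lof (codeOf I t d) y) y) := by
  rw [RtnW, Function.comp_apply]
  simp only [fanoutFn_apply, ncW_input, MbinW_input, idxMW_input, idxnW_input, yfW_input]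
  rw [normMatF_apply _ (by rw [yardW_input_length]; exact n_le_L I t d y) (by rw [yardW_input_length, dM]; exact min_le_right _ _)]
  refine congrArg matCode (funext fun k => funext fun r => ?_)
  have hv : (elemOf (nthF 5 y) k).length ≤ (yardW (boolPair (codeOf I t d) y)).length := by
    rw [yardW_input_length]
    exact ((length_elemOf_le _ _).trans (length_nthF_le 5 y)).trans (length_wit_le_L I t d y)
  rw [capZ_ival_elemOf hv, dRt]

/-- `ddW` on the input. [folklore] -/
theorem ddW_input : ddW (boolPair (codeOf I t d) y) = dpEnc (dδ y) := by
  simp [ddW, dδ]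

end Components

/-! ### No overflow in `g = t C` -/

/-- The target entries are below `2^{|x|}` in absolute value. [folklore] -/
theorem natAbs_target_lt (I : LatticeInstance) (t : Fin I.n → ℤ) (d : ℚ) (l : Fin I.n) :
    (t l).natAbs < 2 ^ (codeOf I t d).length := by
  have h1 : t l = smval (elemOf (frames (List.ofFn fun k => encodingIntBool.encode (t k))) l) := by
    rw [frames_eq_encList, elemOf_encList, List.getD_eq_getElem _ _ (by simp), List.getElem_ofFn, smval_encode]
  rw [h1]
  exact lt_of_lt_of_le (natAbs_smval_lt _) (Nat.pow_le_pow_right (by norm_num)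
    ((length_elemOf_le _ _).trans (sizes_input I t d).2.2.2))

/-- **No overflow**: `|g k| = |∑ₗ W k l tₗ| < 2^{|Y|}`. [folklore] -/
theorem natAbs_dg_lt (I : LatticeInstance) (t : Fin I.n → ℤ) (d : ℚ) (y : List Bool) (k : Fin I.n) :
    (dg I.n y t k).natAbs < 2 ^ Lof (codeOf I t d) y := by
  set x := codeOf I t d with hx
  have hterm : ∀ l : Fin I.n, (dW I.n y k l * t l).natAbs ≤ 2 ^ y.length * 2 ^ x.length := fun l => by
    rw [Int.natAbs_mul]
    refine Nat.mul_le_mul ?_ (natAbs_target_lt I t d l).le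
    exact (lt_of_lt_of_le (natAbs_ival_lt _) (Nat.pow_le_pow_right (by norm_num)
      ((length_elemOf_le _ _).trans ((length_elemOf_le _ _).trans (length_nthF_le 2 y))))).le
  have hsum : (dg I.n y t k).natAbs ≤ I.n * (2 ^ y.length * 2 ^ x.length) := by
    rw [dg]
    refine (Int.natAbs_sum_le _ _).trans ?_
    calc ∑ l, (dW I.n y k l * t l).natAbs ≤ ∑ _l : Fin I.n, 2 ^ y.length * 2 ^ x.length := Finset.sum_le_sum fun l _ => hterm l
      _ = I.n * (2 ^ y.length * 2 ^ x.length) := by simp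
  have hn : I.n < 2 ^ x.length := lt_of_le_of_lt (sizes_input I t d).1 Nat.lt_two_pow_self
  calc (dg I.n y t k).natAbs ≤ I.n * (2 ^ y.length * 2 ^ x.length) := hsum
    _ < 2 ^ x.length * (2 ^ y.length * 2 ^ x.length) := Nat.mul_lt_mul_of_pos_right hn (by positivity)
    _ = 2 ^ (2 * x.length + y.length) := by rw [← pow_add, ← pow_add]; ring_nf
    _ ≤ 2 ^ Lof x y := Nat.pow_le_pow_right (by norm_num) (by rw [Lof, length_boolPair]; omega)

/-- `gnW` on the input: the canonical code of `g = t C` (no overflow). [folklore] -/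
theorem gnW_input (I : LatticeInstance) (t : Fin I.n → ℤ) (d : ℚ) (y : List Bool) :
    gnW (boolPair (codeOf I t d) y) = rowCode (dg I.n y t) := by
  rw [gnW, Function.comp_apply]
  simp only [fanoutFn_apply, ncW_input, tnW_input, WnW_input]
  rw [gVecF_apply _ (by rw [yardW_input_length]; exact n_le_L I t d y)]
  refine congrArg rowCode (funext fun k => ?_)
  rw [yardW_input_length]
  exact capZ_of_lt (natAbs_dg_lt I t d y k)

/-! ### The record and the verifier on an input -/

/-- **`prepW` on an input `⟨code ((B,t),d), y⟩`**: the record of genuine codes of the instance data and of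
the data decoded from `y`. [folklore] -/
theorem prepW_input (I : LatticeInstance) (t : Fin I.n → ℤ) (d : ℚ) (y : List Bool) :
    prepW (boolPair (codeOf I t d) y) =
      mkG (yardW (boolPair (codeOf I t d) y)) (encodeNat I.n) (matCode (fun i k : Fin I.n => I.basis i k)) (rowCode t)
        (encodeNat (dN (Lof (codeOf I t d) y) y)) (matCode (dU I.n (Lof (codeOf I t d) y) y)) (matCode (dW I.n y))
        (dpEnc (dδ y)) (encodeNat (dM (Lof (codeOf I t d) y) y)) (matCode (dRt I.n (Lof (codeOf I t d) y) y)) (sndPow 5 y)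
        (encodeNat d.num.natAbs) (encodeNat d.den) (idxList I.n) (rowCode (dg I.n y t)) := by
  rw [prepW]
  simp only [fanoutFn_apply, ncW_input, BnW_input, tnW_input, NbinW_input, UnW_input, WnW_input, ddW_input, MbinW_input,
    RtnW_input, ysW_input, numW_input, denW_input, idxnW_input, gnW_input]
  rfl

/-- The conjunction tested by the machine, on the decoded data. [folklore] -/
def MachineAcc (I : LatticeInstance) (t : Fin I.n → ℤ) (d : ℚ) (y : List Bool) : Prop :=
  dδ y ≠ 0 ∧ (∀ i k : Fin I.n, ∑ l, I.basis i l * dW I.n y k l = if i = k then dδ y else 0) ∧ 0 < dσ y ∧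
    (∀ i k : Fin I.n, ((dσ y : ℤ) * dσ y) *
      (((dN (Lof (codeOf I t d) y) y : ℤ) * ((d.den : ℤ) * d.den)) * ∑ l, I.basis i l * I.basis k l -
        (20000 * ((d.num.natAbs : ℤ) * d.num.natAbs)) * ∑ j, dU I.n (Lof (codeOf I t d) y) y i j * dU I.n (Lof (codeOf I t d) y) y k j) -
      ∑ r, dRt I.n (Lof (codeOf I t d) y) y i r * dRt I.n (Lof (codeOf I t d) y) y k r = 0) ∧
    dN (Lof (codeOf I t d) y) y < 4 * (Finset.univ.filter (FarPhase (dU I.n (Lof (codeOf I t d) y) y) (dg I.n y t) (dδ y))).card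

/-- **The verifier on an input**: the bit of `MachineAcc`. [folklore] -/
theorem verifW_input (I : LatticeInstance) (t : Fin I.n → ℤ) (d : ℚ) (y : List Bool) [Decidable (MachineAcc I t d y)] :
    verifW (boolPair (codeOf I t d) y) = [decide (MachineAcc I t d y)] := by
  rw [verifW, Function.comp_apply, prepW_input,
    testsF_apply _ _ _ _ (by rw [yardW_input_length]; exact n_le_L I t d y) (by rw [yardW_input_length, dN]; exact min_le_right _ _)
      (by rw [yardW_input_length, dM]; exact min_le_right _ _)]
  simp only [bitsToNat_encodeNat, MachineAcc, dσ]
  congr 1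
  rw [decide_eq_decide]

/-! ### From the machine's conjunction to `FarCert.Accepts` -/

/-- For square integer matrices, `B C = δ I` with `δ ≠ 0` implies `C B = δ I` (over `ℚ`, `B (C/δ) = I`
gives `(C/δ) B = I`, `Matrix.mul_eq_one_comm`). [folklore] -/
theorem mul_eq_smul_one_comm {n : ℕ} {B C : Matrix (Fin n) (Fin n) ℤ} {δ : ℤ} (hδ : δ ≠ 0) (h : B * C = δ • (1 : Matrix _ _ ℤ)) :
    C * B = δ • (1 : Matrix _ _ ℤ) := by
  set f := Int.castRingHom ℚ with hf
  have hmap1 : ∀ M : Matrix (Fin n) (Fin n) ℤ, (δ • M).map f = (δ : ℚ) • M.map f := fun M => by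
    ext i j; simp only [Matrix.map_apply, Matrix.smul_apply, smul_eq_mul, hf, eq_intCast, Int.cast_mul]
  have hone : (1 : Matrix (Fin n) (Fin n) ℤ).map f = 1 := Matrix.map_one f (map_zero f) (map_one f)
  have hq : B.map f * C.map f = (δ : ℚ) • 1 := by rw [← Matrix.map_mul, h, hmap1, hone]
  have hδq : (δ : ℚ) ≠ 0 := by exact_mod_cast hδ
  have h1 : B.map f * ((δ : ℚ)⁻¹ • C.map f) = 1 := by
    rw [Matrix.mul_smul, hq, smul_smul, inv_mul_cancel₀ hδq, one_smul]
  have h2 := mul_eq_one_comm.1 h1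
  have h3 : C.map f * B.map f = (δ : ℚ) • 1 := by
    rw [Matrix.smul_mul] at h2
    have := congrArg (fun M : Matrix (Fin n) (Fin n) ℚ => (δ : ℚ) • M) h2
    simp only [smul_smul, mul_inv_cancel₀ hδq, one_smul] at this
    exact this
  have h4 : (C * B).map f = (δ • (1 : Matrix (Fin n) (Fin n) ℤ)).map f := by
    rw [Matrix.map_mul, h3, hmap1, hone]
  exact Matrix.map_injective (RingHom.injective_int f) h4

/-- **The decoded certificate** of dimension `n` read off a witness string `y` under the length bound `L`
(total; transposed storage: `A j k = U k j`, `C i k = W k i`, `R i k = Rt k i`). [folklore] -/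
def decCert (n L : ℕ) (y : List Bool) : FarCert n :=
  ⟨dN L y, fun j k => dU n L y k j, fun i k => dW n y k i, dδ y, dM L y, fun i k => dRt n L y k i, dσ y⟩

section DecCertFields
variable (n L : ℕ) (y : List Bool)
/-- Field `N` of the decoded certificate. [folklore] -/
@[simp] theorem decCert_N : (decCert n L y).N = dN L y := rfl
/-- Field `A` of the decoded certificate. [folklore] -/
@[simp] theorem decCert_A : (decCert n L y).A = fun j k => dU n L y k j := rfl
/-- Field `C` of the decoded certificate. [folklore] -/
@[simp] theorem decCert_C : (decCert n L y).C = fun i k => dW n y k i := rfl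
/-- Field `δ` of the decoded certificate. [folklore] -/
@[simp] theorem decCert_δ : (decCert n L y).δ = dδ y := rfl
/-- Field `m` of the decoded certificate. [folklore] -/
@[simp] theorem decCert_m : (decCert n L y).m = dM L y := rfl
/-- Field `R` of the decoded certificate. [folklore] -/
@[simp] theorem decCert_R : (decCert n L y).R = fun i k => dRt n L y k i := rfl
/-- Field `σ` of the decoded certificate. [folklore] -/
@[simp] theorem decCert_σ : (decCert n L y).σ = dσ y := rfl
end DecCertFields

/-- The far predicate of the decoded certificate is the machine's `FarPhase`. [folklore] -/
theorem far_decCert_iff (I : LatticeInstance) (t : Fin I.n → ℤ) (d : ℚ) (y : List Bool) (j : Fin (dN (Lof (codeOf I t d) y) y)) :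
    (decCert I.n (Lof (codeOf I t d) y) y).Far t j ↔ FarPhase (dU I.n (Lof (codeOf I t d) y) y) (dg I.n y t) (dδ y) j := by
  have hph : (decCert I.n (Lof (codeOf I t d) y) y).phase t j = ∑ i, dU I.n (Lof (codeOf I t d) y) y i j * dg I.n y t i := by
    rw [FarCert.phase, dotProduct]
    refine Finset.sum_congr rfl fun k _ => ?_
    simp only [decCert, Matrix.vecMul, dotProduct, dg]
    congr 1
    exact Finset.sum_congr rfl fun l _ => mul_comm _ _
  rw [FarCert.Far, hph, FarPhase]
  rfl

/-- **`Accepts` of the decoded certificate is the machine's conjunction.** [folklore] -/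
theorem accepts_decCert_iff (I : LatticeInstance) (t : Fin I.n → ℤ) (d : ℚ) (y : List Bool) :
    (decCert I.n (Lof (codeOf I t d) y) y).Accepts ((⟨I, t⟩ : CVPInstance), d) ↔ MachineAcc I t d y := by
  set L := Lof (codeOf I t d) y with hL
  set c := decCert I.n L y with hc
  -- the tests one by one
  have hBC : I.basis * c.C = c.δ • (1 : Matrix _ _ ℤ) ↔ ∀ i k : Fin I.n, ∑ l, I.basis i l * dW I.n y k l = if i = k then dδ y else 0 := by
    rw [← Matrix.ext_iff]
    refine forall_congr' fun i => forall_congr' fun k => ?_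
    rw [Matrix.mul_apply, Matrix.smul_apply, Matrix.one_apply, smul_eq_mul, mul_ite, mul_one, mul_zero]
    rfl
  have hmom : ((c.σ : ℤ) ^ 2) • c.momentMatrix I.basis d = c.Rᵀ * c.R ↔
      ∀ i k : Fin I.n, ((dσ y : ℤ) * dσ y) *
        (((dN L y : ℤ) * ((d.den : ℤ) * d.den)) * ∑ l, I.basis i l * I.basis k l -
          (20000 * ((d.num.natAbs : ℤ) * d.num.natAbs)) * ∑ j, dU I.n L y i j * dU I.n L y k j) -
        ∑ r, dRt I.n L y i r * dRt I.n L y k r = 0 := by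
    rw [← Matrix.ext_iff]
    refine forall_congr' fun i => forall_congr' fun k => ?_
    rw [sub_eq_zero, Matrix.smul_apply, smul_eq_mul, FarCert.momentMatrix, Matrix.sub_apply, Matrix.smul_apply, Matrix.smul_apply,
      smul_eq_mul, smul_eq_mul, Matrix.mul_apply, Matrix.mul_apply, Matrix.mul_apply, Int.natAbs_mul_self', sq, sq, sq]
    simp only [Matrix.transpose_apply]
    rfl
  have hcnt : c.farCount t = (Finset.univ.filter (FarPhase (dU I.n L y) (dg I.n y t) (dδ y))).card := by
    rw [FarCert.farCount]
    congr 1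
    exact Finset.filter_congr fun j _ => far_decCert_iff I t d y j
  constructor
  · rintro ⟨hδ, -, hBC', hσ, hm, hN⟩
    exact ⟨hδ, hBC.1 hBC', Nat.pos_of_ne_zero hσ, hmom.1 hm, by rw [← hcnt]; exact hN⟩
  · rintro ⟨hδ, hBC', hσ, hm, hN⟩
    have h2 : I.basis * c.C = c.δ • (1 : Matrix _ _ ℤ) := hBC.2 hBC'
    exact ⟨hδ, mul_eq_smul_one_comm hδ h2, h2, Nat.pos_iff_ne_zero.1 hσ, hmom.2 hm, by rw [hcnt]; exact hN⟩

/-- **Transport of `Accepts`** along equal data with reindexed sample and row counts. [folklore] -/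
theorem accepts_congr {p : GapCVPInstance} :
    ∀ {c c' : FarCert p.1.I.n} (hN : c.N = c'.N) (hm : c.m = c'.m)
      (_hA : ∀ j k, c.A j k = c'.A (Fin.cast hN j) k) (_hC : c.C = c'.C) (_hδ : c.δ = c'.δ)
      (_hR : ∀ i k, c.R i k = c'.R (Fin.cast hm i) k) (_hσ : c.σ = c'.σ), c.Accepts p ↔ c'.Accepts p := by
  rintro ⟨N, A, C, δ, m, R, σ⟩ ⟨N', A', C', δ', m', R', σ'⟩ hN hm hA hC hδ hR hσ
  dsimp only at hN hm hA hC hδ hR hσ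
  subst hN; subst hm; subst hC; subst hδ; subst hσ
  have hA' : A = A' := funext fun j => funext fun k => by simpa using hA j k
  have hR' : R = R' := funext fun i => funext fun k => by simpa using hR i k
  subst hA'; subst hR'
  exact Iff.rfl

/-! ### The coding of certificates and the three clauses of `FarCert.verifier_mem_P` -/

/-- **The coding of a certificate** as a witness string: `⟨bin N, ⟨matCode Aᵀ, ⟨matCode Cᵀ, ⟨dpEnc δ, ⟨bin m,
⟨matCode Rᵀ, bin σ⟩⟩⟩⟩⟩⟩` (matrices transposed, so that every product the verifier needs is a dot product
of stored rows). [folklore] -/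
def encCert (n : ℕ) (c : FarCert n) : List Bool :=
  boolPair (encodeNat c.N) (boolPair (matCode (fun (k : Fin n) (j : Fin c.N) => c.A j k)) (boolPair (matCode (fun k i : Fin n => c.C i k))
    (boolPair (dpEnc c.δ) (boolPair (encodeNat c.m) (boolPair (matCode (fun (k : Fin n) (i : Fin c.m) => c.R i k)) (encodeNat c.σ))))))

/-- Rows of a matrix code by `elemOf`. [folklore] -/
theorem elemOf_matCode {r s : ℕ} (M : Fin r → Fin s → ℤ) (k : Fin r) : elemOf (matCode M) k = rowCode (M k) := by
  rw [matCode, elemOf_encList, List.getD_eq_getElem _ _ (by simp)]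
  simp

/-- Entries of a row code by `elemOf`. [folklore] -/
theorem ival_elemOf_rowCode {s : ℕ} (v : Fin s → ℤ) (j : Fin s) : ival (elemOf (rowCode v) j) = v j := by
  rw [rowCode_eq_ofFn, elemOf_encList, List.getD_eq_getElem _ _ (by simp)]
  simp

/-- An item of a coded list, with its framing, fits into the code: `2|a| + 2 ≤ |encList L|`. [folklore] -/
theorem two_mul_length_add_two_le_length_encList {L : List (List Bool)} {a : List Bool} (h : a ∈ L) :
    2 * a.length + 2 ≤ (encList L).length := by
  induction L with
  | nil => cases h
  | cons b L ih =>
    rw [encList_cons, length_boolPair]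
    rcases List.mem_cons.1 h with rfl | h'
    · omega
    · have := ih h'; omega

/-- A row code of `s` entries has length at least `s`. [folklore] -/
theorem le_length_rowCode {s : ℕ} (v : Fin s → ℤ) : s ≤ (rowCode v).length := by
  rw [rowCode_eq_ofFn]
  suffices h : ∀ L : List (List Bool), L.length ≤ (encList L).length by simpa using h (List.ofFn fun k => dpEnc (v k))
  intro L
  induction L with
  | nil => simp
  | cons a L ih => rw [encList_cons, length_boolPair, List.length_cons]; omega

/-- With at least one row, the row length of a matrix code is at most its length. [folklore] -/
theorem cols_le_length_matCode {r s : ℕ} (hr : 0 < r) (M : Fin r → Fin s → ℤ) : s ≤ (matCode M).length :=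
  (le_length_rowCode (M ⟨0, hr⟩)).trans ((by omega : ∀ {a b : ℕ}, 2 * a + 2 ≤ b → a ≤ b)
    (two_mul_length_add_two_le_length_encList (by rw [List.mem_ofFn]; exact ⟨⟨0, hr⟩, rfl⟩)))

section EncDec

variable {n : ℕ} (c : FarCert n) {L : ℕ}

/-- `N` is recovered (`N ≤ L`). [folklore] -/
theorem dN_encCert (hN : c.N ≤ L) : dN L (encCert n c) = c.N := by
  simp [dN, encCert, hN]

/-- `m` is recovered (`m ≤ L`). [folklore] -/
theorem dM_encCert (hm : c.m ≤ L) : dM L (encCert n c) = c.m := by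
  simp [dM, encCert, hm]

/-- `A` is recovered. [folklore] -/
theorem dU_encCert (k : Fin n) (j : Fin (dN L (encCert n c))) (hj : (j : ℕ) < c.N) :
    dU n L (encCert n c) k j = c.A ⟨j, hj⟩ k := by
  rw [dU, show nthF 1 (encCert n c) = matCode (fun (k : Fin n) (j : Fin c.N) => c.A j k) by simp [encCert], elemOf_matCode]
  exact ival_elemOf_rowCode (fun j => c.A j k) ⟨j, hj⟩

/-- `C` is recovered. [folklore] -/
theorem dW_encCert (k l : Fin n) : dW n (encCert n c) k l = c.C l k := by
  rw [dW, show nthF 2 (encCert n c) = matCode (fun k i : Fin n => c.C i k) by simp [encCert], elemOf_matCode, ival_elemOf_rowCode]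

/-- `δ` is recovered. [folklore] -/
theorem dδ_encCert : dδ (encCert n c) = c.δ := by simp [dδ, encCert]

/-- `R` is recovered. [folklore] -/
theorem dRt_encCert (k : Fin n) (i : Fin (dM L (encCert n c))) (hi : (i : ℕ) < c.m) :
    dRt n L (encCert n c) k i = c.R ⟨i, hi⟩ k := by
  rw [dRt, show nthF 5 (encCert n c) = matCode (fun (k : Fin n) (i : Fin c.m) => c.R i k) by simp [encCert], elemOf_matCode]
  exact ival_elemOf_rowCode (fun i => c.R i k) ⟨i, hi⟩

/-- `σ` is recovered. [folklore] -/
theorem dσ_encCert : dσ (encCert n c) = c.σ := by simp [dσ, encCert]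

end EncDec

/-- In dimension `0` no certificate is accepted (all phases vanish, so no phase is far, and `N < 0` fails).
[folklore] -/
theorem not_accepts_of_n_zero {p : GapCVPInstance} (h0 : p.1.I.n = 0) (c : FarCert p.1.I.n) : ¬ c.Accepts p := by
  rintro ⟨hδ, -, -, -, -, hN⟩
  have hfar : ∀ j, ¬ c.Far p.1.target j := by
    intro j hj
    have hph : c.phase p.1.target j = 0 := by
      rw [FarCert.phase, dotProduct]
      exact Finset.sum_eq_zero fun k _ => by
        have hk : (k : ℕ) < 0 := h0 ▸ k.isLt
        exact absurd hk (Nat.not_lt_zero _)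
    rw [FarCert.Far, hph, Int.zero_emod, mul_zero] at hj
    have : (0 : ℤ) < c.δ.natAbs := by exact_mod_cast Int.natAbs_pos.2 hδ
    exact absurd hj.1 (not_le.2 this)
  have hcount : c.farCount p.1.target = 0 := by
    rw [FarCert.farCount, Finset.card_eq_zero, Finset.filter_eq_empty_iff]
    exact fun j _ => hfar j
  rw [hcount] at hN
  exact Nat.not_lt_zero _ hN

/-- **Decoding the coding**: `Accepts` is invariant (`N, m ≤ L`). [folklore] -/
theorem accepts_decCert_encCert {p : GapCVPInstance} (c : FarCert p.1.I.n) {L : ℕ} (hNL : c.N ≤ L) (hmL : c.m ≤ L) :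
    (decCert p.1.I.n L (encCert p.1.I.n c)).Accepts p ↔ c.Accepts p := by
  have hN' : (decCert p.1.I.n L (encCert p.1.I.n c)).N = c.N := dN_encCert c hNL
  have hm' : (decCert p.1.I.n L (encCert p.1.I.n c)).m = c.m := dM_encCert c hmL
  have hσ' : (decCert p.1.I.n L (encCert p.1.I.n c)).σ = c.σ := by rw [decCert_σ]; exact dσ_encCert c
  have hδ' : (decCert p.1.I.n L (encCert p.1.I.n c)).δ = c.δ := by rw [decCert_δ]; exact dδ_encCert c
  have hC' : (decCert p.1.I.n L (encCert p.1.I.n c)).C = c.C := by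
    rw [decCert_C]; exact funext fun i => funext fun k => dW_encCert c k i
  refine accepts_congr hN' hm' (fun j k => ?_) hC' hδ' (fun i k => ?_) hσ'
  · have hj : (j : ℕ) < c.N := lt_of_lt_of_eq j.isLt hN'
    rw [decCert_A]
    exact dU_encCert c k j hj
  · have hi : (i : ℕ) < c.m := lt_of_lt_of_eq i.isLt hm'
    rw [decCert_R]
    exact dRt_encCert c k i hi

/-- With at least one row, `N, m ≤ |encCert c|`. [folklore] -/
theorem sizes_encCert {n : ℕ} (hn : 0 < n) (c : FarCert n) : c.N ≤ (encCert n c).length ∧ c.m ≤ (encCert n c).length := by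
  constructor
  · refine (cols_le_length_matCode hn (fun (k : Fin n) (j : Fin c.N) => c.A j k)).trans ?_
    rw [encCert, length_boolPair, length_boolPair]; omega
  · refine (cols_le_length_matCode hn (fun (k : Fin n) (i : Fin c.m) => c.R i k)).trans ?_
    simp only [encCert, length_boolPair]; omega

/-- **Clause (i)**: on the code of an instance, the coded certificate is accepted by the machine iff the
certificate is accepted. [cite: AharonovRegev2005, §6 (p. 10)] -/
theorem verifW_encCert (p : GapCVPInstance) (c : FarCert p.1.I.n) :
    verifW (boolPair (gapCVPInstanceEncoding.encode p) (encCert _ c)) = [true] ↔ c.Accepts p := by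
  classical
  obtain ⟨⟨I, t⟩, d⟩ := p
  change FarCert I.n at c
  rw [show gapCVPInstanceEncoding.encode ((⟨I, t⟩ : CVPInstance), d) = codeOf I t d from rfl, verifW_input]
  simp only [List.cons.injEq, and_true, decide_eq_true_eq]
  rw [← accepts_decCert_iff]
  rcases Nat.eq_zero_or_pos I.n with h0 | hn
  · constructor
    · intro h; exact absurd h (not_accepts_of_n_zero h0 _)
    · intro h; exact absurd h (not_accepts_of_n_zero h0 _)
  · have hy : (encCert I.n c).length ≤ Lof (codeOf I t d) (encCert I.n c) := length_wit_le_L I t d _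
    have hs := sizes_encCert hn c
    exact accepts_decCert_encCert (p := ((⟨I, t⟩ : CVPInstance), d)) c (hs.1.trans hy) (hs.2.trans hy)

/-- **Clause (ii)**: every accepted string denotes an accepted certificate (the decoded one). [folklore] -/
theorem accepts_decCert_of_verifW (p : GapCVPInstance) (w : List Bool)
    (h : verifW (boolPair (gapCVPInstanceEncoding.encode p) w) = [true]) : ∃ c : FarCert p.1.I.n, c.Accepts p := by
  classical
  obtain ⟨⟨I, t⟩, d⟩ := p
  rw [show gapCVPInstanceEncoding.encode ((⟨I, t⟩ : CVPInstance), d) = codeOf I t d from rfl, verifW_input] at h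
  simp only [List.cons.injEq, and_true, decide_eq_true_eq] at h
  exact ⟨decCert I.n _ w, (accepts_decCert_iff I t d w).2 h⟩

/-! ### The length of the coding -/

/-- Length of a row code: `≤ 6 ∑ sizes + 6 s`. [folklore] -/
theorem length_rowCode_le {s : ℕ} (v : Fin s → ℤ) : (rowCode v).length ≤ 6 * ∑ j, (v j).natAbs.size + 6 * s := by
  rw [rowCode_eq_ofFn, length_encList, List.map_ofFn, List.sum_ofFn]
  have : ∀ j, 2 * (dpEnc (v j)).length + 2 ≤ 6 * (v j).natAbs.size + 6 := fun j => by
    have := length_dpEnc_le (v j); omega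
  calc ∑ j, (2 * (dpEnc (v j)).length + 2) ≤ ∑ j, (6 * (v j).natAbs.size + 6) := Finset.sum_le_sum fun j _ => this j
    _ = 6 * ∑ j, (v j).natAbs.size + 6 * s := by rw [Finset.sum_add_distrib, Finset.mul_sum]; simp [mul_comm]

/-- Length of a matrix code: `≤ 12 ∑∑ sizes + 12 r s + 2 r`. [folklore] -/
theorem length_matCode_le {r s : ℕ} (M : Fin r → Fin s → ℤ) :
    (matCode M).length ≤ 12 * ∑ k, ∑ j, (M k j).natAbs.size + 12 * (r * s) + 2 * r := by
  rw [matCode, length_encList, List.map_ofFn, List.sum_ofFn]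
  have : ∀ k, 2 * (rowCode (M k)).length + 2 ≤ 12 * ∑ j, (M k j).natAbs.size + 12 * s + 2 := fun k => by
    have := length_rowCode_le (M k); omega
  calc ∑ k, (2 * (rowCode (M k)).length + 2) ≤ ∑ k, (12 * ∑ j, (M k j).natAbs.size + 12 * s + 2) := Finset.sum_le_sum fun k _ => this k
    _ = 12 * ∑ k, ∑ j, (M k j).natAbs.size + 12 * (r * s) + 2 * r := by
        rw [Finset.sum_add_distrib, Finset.sum_add_distrib, Finset.mul_sum]; simp; ring

/-- **Clause (iii)**: the coding is polynomial (indeed linear) in the bit size: `|encCert c| ≤ 40 · bitSize c + 40`.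
[folklore] -/
theorem length_encCert_le {n : ℕ} (c : FarCert n) : (encCert n c).length ≤ (40 * X + 40 : Polynomial ℕ).eval c.bitSize := by
  simp only [eval_add, eval_mul, eval_ofNat, eval_X]
  have hA := length_matCode_le (fun (k : Fin n) (j : Fin c.N) => c.A j k)
  have hC := length_matCode_le (fun k i : Fin n => c.C i k)
  have hR := length_matCode_le (fun (k : Fin n) (i : Fin c.m) => c.R i k)
  rw [Finset.sum_comm] at hA hC hR
  have hδ := length_dpEnc_le c.δ
  have hN := length_encodeNat_le_self c.N
  have hm := length_encodeNat_le_self c.m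
  have hσ : (encodeNat c.σ).length = c.σ.size := TM2Pass.length_encodeNat_eq_size _
  have hn : n ≤ n * n := Nat.le_mul_self n
  rw [encCert]
  simp only [length_boolPair]
  rw [FarCert.bitSize]
  set SA := ∑ j, ∑ k, (c.A j k).natAbs.size
  set SC := ∑ i, ∑ k, (c.C i k).natAbs.size
  set SR := ∑ j, ∑ k, (c.R j k).natAbs.size
  have e1 : n * c.N = c.N * n := mul_comm _ _
  have e2 : n * c.m = c.m * n := mul_comm _ _
  rw [e1] at hA
  rw [e2] at hR
  set P1 := c.N * n
  set P2 := n * n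
  set P3 := c.m * n
  omega

/-! ### Discharge of `FarCert.verifier_mem_P` -/

/-- The language of the verifier. [folklore] -/
def farCertLang : Language Bool := {w | verifW w = [true]}

/-- `farCertLang ∈ P`. [cite: AroraBarakCC2009, Def. 1.13 and §1.3] -/
theorem farCertLang_mem_P : farCertLang ∈ Classes.P :=
  mem_P_of_mem_FP verifW_mem_FP _ fun w =>
    ⟨fun h => h, fun h => by
      obtain ⟨b, hb⟩ := oneBit_verifW w
      cases b
      · exact hb
      · exact absurd hb h⟩

end FarCertMachine

/-- **Discharge of `FarCert.verifier_mem_P`** (Aharonov–Regev 2005, §6, p. 10: "It is easy to see that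
the verifier can be implemented in polynomial time"): the verifier of the integer certificate `FarCert`
is a polynomial-time machine — the `FP` string function `FarCertMachine.verifW` (normalisation of the
witness matrices by total decoding, then the tests `δ ≠ 0`, `B C = δ I`, `σ ≠ 0`, `σ² Q = RᵀR` entrywise by
dot products of stored rows, and the far count of the phases `col_j(Aᵀ) · (t C)` against `N/4`), with the
coding `FarCertMachine.encCert` (transposed matrices) of linear length in the bit size.
[cite: AharonovRegev2005, §6 (p. 10)] -/
theorem FarCert.verifier_mem_P_holds : FarCert.verifier_mem_P := by
  refine ⟨FarCertMachine.farCertLang, FarCertMachine.farCertLang_mem_P, FarCertMachine.encCert, 40 * X + 40, ?_, ?_, ?_⟩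
  · intro p c
    exact FarCertMachine.verifW_encCert p c
  · intro p w hw
    exact FarCertMachine.accepts_decCert_of_verifW p w hw
  · intro n c
    exact FarCertMachine.length_encCert_le c

end Literature.Algebra.EuclideanLattices
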